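import Literature.NumberTheory.Transcendental.TwoCurveBaker
import Literature.NumberTheory.Transcendental.NewPointsTorsion
import HarnessLib

/-!
# Baker's method on the two-lattice standard models: orbit count, extrapolation, new points, the engine

Topic `Literature/NumberTheory/Transcendental`; unit
`provefact-Literature.NumberTheory.Transcendental.H-a66b67e3eb` (fact
`Literature.NumberTheory.Transcendental.HuberWustholzTwoCurvePeriods`). It introduces NO named fact.
Two-lattice counterpart (stage E of the port) of the one-lattice files `TorsionOrbit.lean`
(orbit count, division points, `ker`-periodicity of the order of vanishing), `Extrapolation.lean`,
`ThetaBaseLowerBound.lean`, `PointStep.lean`, `ExtrapolationBound.lean`, `ExtrapolationScaled.lean`,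
`ExtrapolationSpaced.lean`, `NewPoints.lean`, `BakerEngine.lean`, `NewPointsScaled.lean`,
`AuxiliaryFunctionSpaced.lean`, `NewPointsTorsion.lean`, for the two-lattice standard models
`M = 𝔾ₘ^β × P` (`TwoCurveStd.lean`, …, `TwoCurveBaker.lean`).

## What is proved here (everything; no `sorry`, no new `def … : Prop`)

* `closure_ker_eq`, `mem_preimageSubgroup_of_tangent_eq_bot`, `le_orbitCard`,
  `exists_bound_forall_notMem_ker` (division points of a torsion point: multiples outside `ker`,
  blockwise lattices), `chartCoord_add_ker`, `vanishesAlong_add_ker_iff`, `vanishesAlong_all_multiples`;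
* `extrapFun`, `vanishesAlong_iff_extrapFun`, `le_analyticOrderAt_extrapFun`, `norm_thetaEval_le`,
  `norm_extrapFun_le(_radius)`, the growth constant `thetaGrowthC`;
* for Baker data: `exists_univExtP_base_ge` / `exists_theta_baseIdx_ge` (lower bound for the base
  theta function at `s·v`, each block with its own lattice), `vanishesAlong_of_levels/small`
  (point step), `norm_extrapFun_grid_le(₂,₃)` (extrapolation bounds), `NumCond(₂,₃)`,
  `vanishesAlong_newPoints(₂,₃)`, `engine`, `engine₂`, `exists_auxiliary₃`, `engine₃` — the Baker
  engine: an auxiliary form with `F_P ≢ 0` vanishing to high order along `𝔟` at `s·v`, `s ≤ S₁`, the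
  hypothesis of the zero estimate.

## References

* A. Baker, G. Wüstholz, *Logarithmic Forms and Diophantine Geometry*, CUP 2007, §6.8 (pp. 116–119).
* P. Philippon, *Lemmes de zéros dans les groupes algébriques commutatifs*, Bull. SMF 114 (1986), Thm. 2.1.
-/

noncomputable section

open Complex Filter Topology MvPolynomial
open scoped PeriodPair

namespace Literature.NumberTheory.Transcendental

namespace GaGmEE

namespace Std

open GaGmE (Kbar)
open GaGmE.Std (iy iz is coords coords_iy coords_iz coords_is sum_blocks ThetaIdx thetaT thetaT_none
  thetaT_some differentiable_thetaT VanishesAlong isAlgebraic_coe_Kbar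
  Gen factorGen zetaHat zetaHatDer factorODE zetaHatODE FactorChartValid isOpen_factorChartValid
  factorGen_false factorGen_true zetaHat_false zetaHat_true hasDerivAt_zetaHat
  baseFin baseIdx rPoly corrPoly TPoly rVal corrVal factor_blocks line_apply genFin genIdx
  rVal_baseFin corrVal_baseFin rVal_genFin genericChart affGen affIdx homog isHomogeneous_homog
  eval_homog_of_base_eq_one factorODEᵣ zetaHatODEᵣ rPolyᵣ corrPolyᵣ TPolyᵣ homogMonomialᵣ
  map_homogMonomialᵣ homog_monomial homog_add homog_zero homog_sum homog_eq_sum)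
open GaGmE.Std.BakerData (UIdx νOf νOf_apply νOf_injective degree_νOf_le degree_mapDomain_affIdx
  degree_eq_sum_support card_UIdx lin_quad_le)

variable {β γ γ' δ : Type} [Fintype β] [Fintype γ] [Fintype γ'] [Fintype δ] [DecidableEq γ] [DecidableEq γ']
variable (L L' : PeriodPair) (κM : δ → γ ⊕ γ' → Kbar)

/-! ### The kernel subgroup, the orbit count, division points -/

section Orbit

open Module Submodule

omit [Fintype β] [Fintype δ] [DecidableEq γ] [DecidableEq γ'] in
/-- `closure(ker) = ker`. [folklore] -/
theorem closure_ker_eq :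
    AddSubgroup.closure (ker L L' κM : Set (β ⊕ ((γ ⊕ γ') ⊕ δ) → ℂ)) = kerSubgroup (β := β) L L' κM :=
  (kerSubgroup (β := β) L L' κM).closure_eq


omit [Fintype β] [Fintype δ] [DecidableEq γ] [DecidableEq γ'] in
/-- Membership in `closure(ker)` is membership in `ker`. [folklore] -/
theorem mem_closure_ker {w : β ⊕ ((γ ⊕ γ') ⊕ δ) → ℂ} :
    w ∈ AddSubgroup.closure (ker L L' κM : Set (β ⊕ ((γ ⊕ γ') ⊕ δ) → ℂ)) ↔ w ∈ ker L L' κM := by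
  rw [closure_ker_eq]; rfl


omit [DecidableEq γ] [DecidableEq γ'] in
/-- **`exp⁻¹(K) = ker` for the zero subgroup** (`Lie K = 0`). [folklore] -/
theorem mem_preimageSubgroup_of_tangent_eq_bot {K : SubgroupDataC β γ γ' δ κM}
    (hK : K.tangent = ⊥) {w : β ⊕ ((γ ⊕ γ') ⊕ δ) → ℂ} : w ∈ preimageSubgroup L L' κM K ↔ w ∈ ker L L' κM := by
  unfold preimageSubgroup
  rw [hK, closure_ker_eq]
  have hbot : (⊥ : Submodule ℂ (β ⊕ ((γ ⊕ γ') ⊕ δ) → ℂ)).toAddSubgroup = ⊥ := rfl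
  rw [hbot, bot_sup_eq]
  rfl


omit [DecidableEq γ] [DecidableEq γ'] in
/-- **Lower bound for `card((Σ + K)/K)`**: if no multiple `r·v`, `0 < r < ℓ`, lies in
`exp⁻¹(K)` and `ℓ ≤ S + 1`, then `0, v, …, (ℓ-1)v` are distinct modulo `exp⁻¹(K)` and
`orbitCard ≥ ℓ`. [cite: Philippon1986, Thm 2.1 (card((Σ+G')/G'))] -/
theorem le_orbitCard (K : SubgroupDataC β γ γ' δ κM) (v : β ⊕ ((γ ⊕ γ') ⊕ δ) → ℂ) {S ℓ : ℕ} (hℓS : ℓ ≤ S + 1)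
    (h : ∀ r : ℕ, 0 < r → r < ℓ → (r : ℂ) • v ∉ preimageSubgroup L L' κM K) :
    ℓ ≤ orbitCard L L' κM K v S := by
  classical
  unfold orbitCard
  -- the classes of `0, …, ℓ - 1` are pairwise distinct and lie in the range
  set f : Fin (S + 1) → (β ⊕ ((γ ⊕ γ') ⊕ δ) → ℂ) ⧸ preimageSubgroup L L' κM K :=
    fun s => QuotientAddGroup.mk ((s : ℂ) • v) with hf
  let g : Fin ℓ → (β ⊕ ((γ ⊕ γ') ⊕ δ) → ℂ) ⧸ preimageSubgroup L L' κM K := fun r => f ⟨r, lt_of_lt_of_le r.isLt hℓS⟩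
  have hg : Function.Injective g := by
    intro r r' hrr'
    by_contra hne
    simp only [g, hf] at hrr'
    rw [QuotientAddGroup.eq] at hrr'
    rcases lt_or_gt_of_ne (fun h' => hne (Fin.ext h')) with hlt | hlt
    · have hmem : (((r' : ℕ) - (r : ℕ) : ℕ) : ℂ) • v ∈ preimageSubgroup L L' κM K := by
        have e : (((r' : ℕ) - (r : ℕ) : ℕ) : ℂ) • v = -(((r : ℕ) : ℂ) • v) + ((r' : ℕ) : ℂ) • v := by
          rw [Nat.cast_sub hlt.le, sub_smul]; abel
        rw [e]; exact hrr'
      exact h _ (Nat.sub_pos_of_lt hlt) (lt_of_le_of_lt (Nat.sub_le _ _) r'.isLt) hmem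
    · have hmem : (((r : ℕ) - (r' : ℕ) : ℕ) : ℂ) • v ∈ preimageSubgroup L L' κM K := by
        have e : (((r : ℕ) - (r' : ℕ) : ℕ) : ℂ) • v = -(-(((r : ℕ) : ℂ) • v) + ((r' : ℕ) : ℂ) • v) := by
          rw [Nat.cast_sub hlt.le, sub_smul]; abel
        rw [e]; exact AddSubgroup.neg_mem _ hrr'
      exact h _ (Nat.sub_pos_of_lt hlt) (lt_of_le_of_lt (Nat.sub_le _ _) r.isLt) hmem
  have hsub : Set.range g ⊆ Set.range f := by
    rintro _ ⟨r, rfl⟩; exact ⟨_, rfl⟩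
  calc ℓ = Fintype.card (Fin ℓ) := (Fintype.card_fin ℓ).symm
    _ = Set.ncard (Set.range g) := by
        rw [Set.ncard_range_of_injective hg, Nat.card_eq_fintype_card]
    _ ≤ Set.ncard (Set.range f) := Set.ncard_le_ncard hsub (Set.finite_range f)


omit [Fintype δ] [DecidableEq γ] [DecidableEq γ'] in
/-- **The orbit of a division point of a torsion point.** If `P₀·w ∈ ker` (`P₀ ≥ 1`) but
`w ∉ ker`, there is `M₀` such that for every prime `ℓ > M₀` and all `0 < r < ℓ`,
`r·(w/ℓ) ∉ ker` (Baker–Wüstholz's "primitive `γ'`, `ord γ = ℓ ord γ'`": here `ℓ` is a prime not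
dividing some non-zero lattice coordinate of `P₀w`, which then cannot divide `r` times it).
[cite: BakerWustholz2007, §6.8 (p. 117)] -/
theorem exists_bound_forall_notMem_ker {w : β ⊕ ((γ ⊕ γ') ⊕ δ) → ℂ} {P₀ : ℕ} (hP₀ : 0 < P₀)
    (hw : (P₀ : ℂ) • w ∈ ker L L' κM) (hwker : w ∉ ker L L' κM) :
    ∃ M₀ : ℕ, ∀ ℓ : ℕ, ℓ.Prime → M₀ < ℓ →
      ∀ r : ℕ, 0 < r → r < ℓ → (r : ℂ) • ((ℓ : ℂ)⁻¹ • w) ∉ ker L L' κM := by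
  classical
  obtain ⟨hy, m, n, hz, hs⟩ := hw
  choose p hp using hy
  have hP₀0 : (P₀ : ℂ) ≠ 0 := by exact_mod_cast hP₀.ne'
  -- the coordinates of `w`
  have hwy : ∀ j, w (iy j) = (P₀ : ℂ)⁻¹ * (p j * (2 * Real.pi * I)) := fun j => by
    have := hp j; simp only [Pi.smul_apply, smul_eq_mul] at this
    rw [← this]; field_simp
  have hwz : ∀ b, w (iz b) = (P₀ : ℂ)⁻¹ * (m b * (lat L L' b).ω₁ + n b * (lat L L' b).ω₂) := fun b => by
    have := hz b; simp only [Pi.smul_apply, smul_eq_mul] at this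
    rw [← this]; field_simp
  have hws : ∀ e, w (is e) = (P₀ : ℂ)⁻¹ * ∑ b, (κM e b : ℂ) * (m b * (lat L L' b).η₁ + n b * (lat L L' b).η₂) := fun e => by
    have := hs e; simp only [Pi.smul_apply, smul_eq_mul] at this
    rw [← this]; field_simp
  -- some coordinate is not divisible by `P₀`… more precisely: not all of `p, m, n` vanish
  -- modulo the statement we need; we bound by the maximum of the absolute values
  set M₀ : ℕ := (Finset.univ.sup fun j => (p j).natAbs) + (Finset.univ.sup fun b => (m b).natAbs) +
    (Finset.univ.sup fun b => (n b).natAbs) + P₀ with hM₀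
  refine ⟨M₀, fun ℓ hℓ hM₀ℓ r hr hrℓ hmem => ?_⟩
  have hℓ0 : (ℓ : ℂ) ≠ 0 := by exact_mod_cast hℓ.ne_zero
  have hℓP : ((ℓ * P₀ : ℕ) : ℂ) ≠ 0 := by exact_mod_cast (Nat.mul_ne_zero hℓ.ne_zero hP₀.ne')
  obtain ⟨hy', m', n', hz', -⟩ := hmem
  -- divisibility of the coordinates: `ℓ ∣ r p_j`, `ℓ ∣ r m_b`, `ℓ ∣ r n_b`
  have hdp : ∀ j, (ℓ : ℤ) ∣ r * p j := by
    intro j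
    obtain ⟨q, hq⟩ := hy' j
    simp only [Pi.smul_apply, smul_eq_mul, hwy j] at hq
    have h2 : (2 * Real.pi * I : ℂ) ≠ 0 := by
      simp [Real.pi_ne_zero, Complex.I_ne_zero]
    have e : ((r : ℂ) * p j) * (2 * Real.pi * I) = ((ℓ : ℂ) * P₀ * q) * (2 * Real.pi * I) := by
      have h' : (ℓ : ℂ) * P₀ * ((r : ℂ) * ((ℓ : ℂ)⁻¹ * ((P₀ : ℂ)⁻¹ * (p j * (2 * Real.pi * I))))) =
          ((ℓ : ℂ) * P₀ * q) * (2 * Real.pi * I) := by rw [hq]; ring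
      rw [← h']; field_simp
    have e' := mul_right_cancel₀ h2 e
    refine ⟨P₀ * q, ?_⟩
    have e'' : ((r * p j : ℤ) : ℂ) = ((ℓ * (P₀ * q) : ℤ) : ℂ) := by push_cast; linear_combination e'
    exact_mod_cast e''
  have hdmn : ∀ b, (ℓ : ℤ) ∣ r * m b ∧ (ℓ : ℤ) ∣ r * n b := by
    intro b
    have hb := hz' b
    simp only [Pi.smul_apply, smul_eq_mul, hwz b] at hb
    have hmemΛ : (((r * m b : ℤ) : ℂ) * (lat L L' b).ω₁ + ((r * n b : ℤ) : ℂ) * (lat L L' b).ω₂) / ((ℓ * P₀ : ℕ) : ℂ) ∈ (lat L L' b).lattice := by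
      have e : (((r * m b : ℤ) : ℂ) * (lat L L' b).ω₁ + ((r * n b : ℤ) : ℂ) * (lat L L' b).ω₂) / ((ℓ * P₀ : ℕ) : ℂ) =
          (r : ℂ) * ((ℓ : ℂ)⁻¹ * ((P₀ : ℂ)⁻¹ * (m b * (lat L L' b).ω₁ + n b * (lat L L' b).ω₂))) := by
        push_cast; field_simp
      rw [e, hb]
      exact (lat L L' b).int_mul_add_int_mul_mem_lattice _ _
    obtain ⟨h1, h2⟩ := (lat L L' b).dvd_of_div_mem_lattice (Nat.mul_pos hℓ.pos hP₀) hmemΛ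
    push_cast at h1 h2
    exact ⟨(Dvd.intro _ rfl : (ℓ : ℤ) ∣ (ℓ : ℤ) * P₀).trans h1, (Dvd.intro _ rfl : (ℓ : ℤ) ∣ (ℓ : ℤ) * P₀).trans h2⟩
  -- `ℓ ∤ r`
  have hℓr : ¬ (ℓ : ℤ) ∣ r := by
    intro h
    have : ℓ ∣ r := by exact_mod_cast h
    exact absurd (Nat.le_of_dvd hr this) (not_le.mpr hrℓ)
  have hprime : Prime (ℓ : ℤ) := Nat.prime_iff_prime_int.mp hℓ
  -- hence `ℓ` divides every coordinate, which are smaller than `ℓ` in absolute value: all zero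
  have small : ∀ x : ℤ, x.natAbs < ℓ → (ℓ : ℤ) ∣ r * x → x = 0 := by
    intro x hx hdvd
    rcases hprime.dvd_or_dvd hdvd with h | h
    · exact absurd h hℓr
    · by_contra hx0
      have := Int.le_of_dvd (Int.natAbs_pos.mpr hx0 |> fun h' => by exact_mod_cast h') (Int.dvd_natAbs.mpr h)
      have : (ℓ : ℤ) ≤ (x.natAbs : ℤ) := by simpa using this
      omega
  have hp0 : ∀ j, p j = 0 := fun j => small _ (by
    have : (p j).natAbs ≤ Finset.univ.sup fun j => (p j).natAbs :=
      Finset.le_sup (f := fun j => (p j).natAbs) (Finset.mem_univ j)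
    omega) (hdp j)
  have hm0 : ∀ b, m b = 0 := fun b => small _ (by
    have : (m b).natAbs ≤ Finset.univ.sup fun b => (m b).natAbs :=
      Finset.le_sup (f := fun b => (m b).natAbs) (Finset.mem_univ b)
    omega) (hdmn b).1
  have hn0 : ∀ b, n b = 0 := fun b => small _ (by
    have : (n b).natAbs ≤ Finset.univ.sup fun b => (n b).natAbs :=
      Finset.le_sup (f := fun b => (n b).natAbs) (Finset.mem_univ b)
    omega) (hdmn b).2
  -- so `w = 0 ∈ ker`
  apply hwker
  have hw0 : w = 0 := by
    funext i
    rcases i with j | b | e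
    · rw [show Sum.inl j = iy j from rfl, hwy j, hp0 j]; simp
    · rw [show Sum.inr (Sum.inl b) = iz b from rfl, hwz b, hm0 b, hn0 b]; simp
    · rw [show Sum.inr (Sum.inr e) = is e from rfl, hws e]
      simp [hm0, hn0]
  rw [hw0]; exact zero_mem_ker L L' κM


omit [Fintype β] [Fintype δ] in
/-- **The affine chart coordinates are `ker`-periodic**: `A_J(w + k) = A_J(w)` for `k ∈ ker`
(all `Θ_J` pick up one and the same non-zero factor). [folklore] -/
theorem chartCoord_add_ker {k : β ⊕ ((γ ⊕ γ') ⊕ δ) → ℂ} (hk : k ∈ ker L L' κM) (J₀ J : Option β × ThetaIdx (γ ⊕ γ') δ)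
    (w : β ⊕ ((γ ⊕ γ') ⊕ δ) → ℂ) : chartCoord L L' κM J₀ J (w + k) = chartCoord L L' κM J₀ J w := by
  obtain ⟨c, hc, h⟩ := exists_theta_add_ker L L' κM w hk
  unfold chartCoord
  rw [h J, h J₀]
  by_cases h0 : theta L L' κM J₀ w = 0
  · simp [h0]
  · rw [mul_div_mul_left _ _ hc]


/-- **Periodicity of the order of vanishing along `𝔟` under `ker(exp)`**: for a form `P` and
`k ∈ ker`, `F_P` vanishes to order `≥ N` along `𝔟` at `w + k` iff it does at `w` (the order is that
of the chart expression `P(A(·))`, and the chart coordinates are `ker`-periodic). Baker–Wüstholz's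
"translation properties of the `T_{sγ}`" (p. 119). [cite: BakerWustholz2007, §6.8 (p. 119)] -/
theorem vanishesAlong_add_ker_iff {P : MvPolynomial (Option β × ThetaIdx (γ ⊕ γ') δ) ℂ} {D : ℕ}
    (hP : P.IsHomogeneous D) (𝔟 : Submodule ℂ (β ⊕ ((γ ⊕ γ') ⊕ δ) → ℂ)) {k : β ⊕ ((γ ⊕ γ') ⊕ δ) → ℂ}
    (hk : k ∈ ker L L' κM) (w : β ⊕ ((γ ⊕ γ') ⊕ δ) → ℂ) (N : ℕ) :
    VanishesAlong 𝔟 (thetaEval L L' κM P) (w + k) N ↔ VanishesAlong 𝔟 (thetaEval L L' κM P) w N := by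
  obtain ⟨J₀, hJ₀⟩ := exists_theta_ne_zero L L' κM w
  have hJ₀' : theta L L' κM J₀ (w + k) ≠ 0 := by
    obtain ⟨c, hc, h⟩ := exists_theta_add_ker L L' κM w hk
    rw [h J₀]; exact mul_ne_zero hc hJ₀
  rw [vanishesAlong_thetaEval_iff_chart L L' κM hP J₀ 𝔟 hJ₀' N,
    vanishesAlong_thetaEval_iff_chart L L' κM hP J₀ 𝔟 hJ₀ N]
  have hfun : ∀ x : β ⊕ ((γ ⊕ γ') ⊕ δ) → ℂ,
      (fun ξ : ℂ => MvPolynomial.eval (fun J => chartCoord L L' κM J₀ J (w + k + ξ • x)) P) =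
        fun ξ : ℂ => MvPolynomial.eval (fun J => chartCoord L L' κM J₀ J (w + ξ • x)) P := by
    intro x; funext ξ
    have e : w + k + ξ • x = (w + ξ • x) + k := by abel
    simp only [e, chartCoord_add_ker L L' κM hk]
  simp only [hfun]


/-- **Zeros at all multiples from zeros at one period of multiples.** If `(P₁ : ℂ) • u ∈ ker`
(`P₁ ≥ 1`) and `F_P` vanishes to order `≥ N` along `𝔟` at `s·u` for all `s < P₁`, then it does so
at `s·u` for every `s ∈ ℕ`. [cite: BakerWustholz2007, §6.8 (p. 119: translation properties)] -/
theorem vanishesAlong_all_multiples {P : MvPolynomial (Option β × ThetaIdx (γ ⊕ γ') δ) ℂ} {D : ℕ}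
    (hP : P.IsHomogeneous D) (𝔟 : Submodule ℂ (β ⊕ ((γ ⊕ γ') ⊕ δ) → ℂ)) {u : β ⊕ ((γ ⊕ γ') ⊕ δ) → ℂ} {P₁ : ℕ}
    (hP₁ : 0 < P₁) (hu : (P₁ : ℂ) • u ∈ ker L L' κM) {N : ℕ}
    (hvan : ∀ s : ℕ, s < P₁ → VanishesAlong 𝔟 (thetaEval L L' κM P) ((s : ℂ) • u) N) (s : ℕ) :
    VanishesAlong 𝔟 (thetaEval L L' κM P) ((s : ℂ) • u) N := by
  -- `s = (s / P₁) P₁ + s % P₁`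
  have hk : (((s / P₁ : ℕ) : ℂ) • ((P₁ : ℂ) • u)) ∈ ker L L' κM := natCast_smul_mem_ker L L' κM hu _
  have e : (s : ℂ) • u = ((s % P₁ : ℕ) : ℂ) • u + ((s / P₁ : ℕ) : ℂ) • ((P₁ : ℂ) • u) := by
    rw [smul_smul, ← add_smul]
    congr 1
    have := Nat.mod_add_div s P₁
    have h' : ((s % P₁ : ℕ) : ℂ) + ((s / P₁ : ℕ) : ℂ) * (P₁ : ℂ) = s := by
      rw [mul_comm]; exact_mod_cast this
    exact h'.symm
  rw [e, vanishesAlong_add_ker_iff L L' κM hP 𝔟 hk]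
  exact hvan _ (Nat.mod_lt _ hP₁)


end Orbit

/-! ### Extrapolation along the line -/

section Extrap

open Metric Set
open scoped ContDiff

/-- **The extrapolation function** `φ_{x,k}(z) = d^k/dξ^k F_P(z·v + ξ·x)|_{ξ=0}` (the polarised,
single-direction variant of `Ψ = Φ^*(LP)` of the source, see the module docstring).
[cite: BakerWustholz2007, §6.8 (pp. 118–119)] -/
def extrapFun (P : MvPolynomial (Option β × ThetaIdx (γ ⊕ γ') δ) ℂ) (v x : β ⊕ ((γ ⊕ γ') ⊕ δ) → ℂ) (k : ℕ)
    (z : ℂ) : ℂ :=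
  iteratedDeriv k (fun ξ : ℂ => thetaEval L L' κM P (z • v + ξ • x)) 0


/-- `φ_{x,k}(z) = D^kF_P(z·v)(x, …, x)`. [folklore] -/
theorem extrapFun_eq (P : MvPolynomial (Option β × ThetaIdx (γ ⊕ γ') δ) ℂ) (v x : β ⊕ ((γ ⊕ γ') ⊕ δ) → ℂ)
    (k : ℕ) (z : ℂ) :
    extrapFun L L' κM P v x k z = iteratedFDeriv ℂ k (thetaEval L L' κM P) (z • v) fun _ => x :=
  iteratedDeriv_line_eq_iteratedFDeriv (contDiff_thetaEval L L' κM P) (z • v) x le_top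


/-- **`φ_{x,k}` is entire.** [folklore] -/
theorem differentiable_extrapFun (P : MvPolynomial (Option β × ThetaIdx (γ ⊕ γ') δ) ℂ)
    (v x : β ⊕ ((γ ⊕ γ') ⊕ δ) → ℂ) (k : ℕ) : Differentiable ℂ (extrapFun L L' κM P v x k) := by
  have e : extrapFun L L' κM P v x k =
      (fun y => iteratedFDeriv ℂ k (thetaEval L L' κM P) y fun _ => x) ∘ fun z : ℂ => z • v := by
    funext z; exact extrapFun_eq L L' κM P v x k z
  rw [e]
  have hg : ContDiff ℂ ω (fun y => iteratedFDeriv ℂ k (thetaEval L L' κM P) y fun _ : Fin k => x) :=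
    (ContinuousMultilinearMap.apply ℂ (fun _ : Fin k => β ⊕ ((γ ⊕ γ') ⊕ δ) → ℂ) ℂ (fun _ => x)).contDiff.comp
      ((contDiff_thetaEval L L' κM P).iteratedFDeriv_right le_top)
  exact (hg.differentiable (by simp)).comp (differentiable_id.smul_const v)


omit [Fintype β] [Fintype δ] in
/-- `φ_{x,k}(s) = d^k/dξ^k F_P(s·v + ξx)|₀`: the vanishing of `φ_{x,k}(s)` for all `x ∈ 𝔟`,
`k < T'` is the vanishing of `F_P` to order `≥ T'` along `𝔟` at `s·v`. [folklore] -/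
theorem vanishesAlong_iff_extrapFun (P : MvPolynomial (Option β × ThetaIdx (γ ⊕ γ') δ) ℂ)
    (𝔟 : Submodule ℂ (β ⊕ ((γ ⊕ γ') ⊕ δ) → ℂ)) (v : β ⊕ ((γ ⊕ γ') ⊕ δ) → ℂ) (s : ℂ) (T' : ℕ) :
    VanishesAlong 𝔟 (thetaEval L L' κM P) (s • v) T' ↔ ∀ x ∈ 𝔟, ∀ k < T', extrapFun L L' κM P v x k s = 0 :=
  Iff.rfl


/-- **Zeros of the extrapolation functions.** If `v, x ∈ 𝔟` and `F_P` vanishes to order `≥ T`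
along `𝔟` at `s·v`, then `φ_{x,k}^{(j)}(s) = 0` for `j + k < T`. [cite: BakerWustholz2007, §6.8 (p. 119)] -/
theorem iteratedDeriv_extrapFun_eq_zero (P : MvPolynomial (Option β × ThetaIdx (γ ⊕ γ') δ) ℂ)
    {𝔟 : Submodule ℂ (β ⊕ ((γ ⊕ γ') ⊕ δ) → ℂ)} {v x : β ⊕ ((γ ⊕ γ') ⊕ δ) → ℂ} (hv : v ∈ 𝔟) (hx : x ∈ 𝔟)
    {s : ℂ} {T : ℕ} (hvan : VanishesAlong 𝔟 (thetaEval L L' κM P) (s • v) T) {j k : ℕ}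
    (hjk : j + k < T) : iteratedDeriv j (extrapFun L L' κM P v x k) s = 0 := by
  have e1 : iteratedDeriv j (extrapFun L L' κM P v x k) s =
      iteratedDeriv j (fun z => extrapFun L L' κM P v x k (s + z)) 0 := by
    rw [iteratedDeriv_comp_const_add]; simp
  have e2 : (fun z => extrapFun L L' κM P v x k (s + z)) =
      fun z : ℂ => iteratedDeriv k (fun ξ : ℂ => thetaEval L L' κM P (s • v + z • v + ξ • x)) 0 := by
    funext z
    simp only [extrapFun, add_smul]
  rw [e1, e2]
  exact iteratedDeriv_iteratedDeriv_line_eq_zero (contDiff_thetaEval L L' κM P) 𝔟 (s • v) T hvan hv hx hjk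


/-- The order of `φ_{x,k}` at `s` is at least `T - k`. [folklore] -/
theorem le_analyticOrderAt_extrapFun (P : MvPolynomial (Option β × ThetaIdx (γ ⊕ γ') δ) ℂ)
    {𝔟 : Submodule ℂ (β ⊕ ((γ ⊕ γ') ⊕ δ) → ℂ)} {v x : β ⊕ ((γ ⊕ γ') ⊕ δ) → ℂ} (hv : v ∈ 𝔟) (hx : x ∈ 𝔟)
    {s : ℂ} {T : ℕ} (hvan : VanishesAlong 𝔟 (thetaEval L L' κM P) (s • v) T) (k : ℕ) :
    ((T - k : ℕ) : ℕ∞) ≤ analyticOrderAt (extrapFun L L' κM P v x k) s :=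
  Baker1975.Analytic.le_analyticOrderAt_of_iteratedDeriv_eq_zero (differentiable_extrapFun L L' κM P v x k)
    fun j hj => iteratedDeriv_extrapFun_eq_zero L L' κM P hv hx hvan (by omega)


/-- **Growth of the forms.** With the constant `C` of `exists_norm_theta_le`: for `P` of total
degree `≤ D`, `|F_P(w)| ≤ ‖P‖₁ · e^{C(1 + ‖w‖²)}^D`. [folklore] -/
theorem norm_thetaEval_le {C : ℝ} (hC0 : 0 ≤ C)
    (hC : ∀ (J : Option β × ThetaIdx (γ ⊕ γ') δ) (w : β ⊕ ((γ ⊕ γ') ⊕ δ) → ℂ), ‖theta L L' κM J w‖ ≤ Real.exp (C * (1 + ‖w‖ ^ 2)))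
    {P : MvPolynomial (Option β × ThetaIdx (γ ⊕ γ') δ) ℂ} {D : ℕ} (hP : P.totalDegree ≤ D) (w : β ⊕ ((γ ⊕ γ') ⊕ δ) → ℂ) :
    ‖thetaEval L L' κM P w‖ ≤ Nesterenko.l1Norm P * Real.exp (C * (1 + ‖w‖ ^ 2)) ^ D := by
  set M := Real.exp (C * (1 + ‖w‖ ^ 2)) with hM
  have hM1 : 1 ≤ M := Real.one_le_exp (by positivity)
  have hmono : ∀ ν ∈ P.support, ‖(ν.prod fun J e => theta L L' κM J w ^ e)‖ ≤ M ^ D := by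
    intro ν hν
    rw [Finsupp.prod, norm_prod]
    have hdeg : ∑ J ∈ ν.support, ν J ≤ D := by
      have h1 : (ν.sum fun _ e => e) ≤ P.totalDegree := MvPolynomial.le_totalDegree hν
      rw [Finsupp.sum] at h1
      exact h1.trans hP
    calc ∏ J ∈ ν.support, ‖theta L L' κM J w ^ ν J‖ ≤ ∏ J ∈ ν.support, M ^ ν J := by
          refine Finset.prod_le_prod (fun J _ => norm_nonneg _) fun J _ => ?_
          rw [norm_pow]
          exact pow_le_pow_left₀ (norm_nonneg _) (hC J w) _
      _ = M ^ ∑ J ∈ ν.support, ν J := Finset.prod_pow_eq_pow_sum _ _ _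
      _ ≤ M ^ D := pow_le_pow_right₀ hM1 hdeg
  unfold thetaEval Nesterenko.l1Norm
  rw [MvPolynomial.eval_eq, Finset.sum_mul]
  refine (norm_sum_le _ _).trans (Finset.sum_le_sum fun ν hν => ?_)
  rw [norm_mul]
  exact mul_le_mul_of_nonneg_left (by simpa [Finsupp.prod] using hmono ν hν) (norm_nonneg _)


/-- **Growth of the extrapolation functions** (Cauchy's estimate on the unit circle in `ξ`):
`|φ_{x,k}(z)| ≤ k! · ‖P‖₁ · e^{C(1 + (‖z‖‖v‖ + ‖x‖)²)·D}`. [cite: Baker1975, Ch. 2 Lemma 4] -/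
theorem norm_extrapFun_le {C : ℝ} (hC0 : 0 ≤ C)
    (hC : ∀ (J : Option β × ThetaIdx (γ ⊕ γ') δ) (w : β ⊕ ((γ ⊕ γ') ⊕ δ) → ℂ), ‖theta L L' κM J w‖ ≤ Real.exp (C * (1 + ‖w‖ ^ 2)))
    {P : MvPolynomial (Option β × ThetaIdx (γ ⊕ γ') δ) ℂ} {D : ℕ} (hP : P.totalDegree ≤ D)
    (v x : β ⊕ ((γ ⊕ γ') ⊕ δ) → ℂ) (k : ℕ) (z : ℂ) :
    ‖extrapFun L L' κM P v x k z‖ ≤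
      k.factorial * (Nesterenko.l1Norm P * Real.exp (C * (1 + (‖z‖ * ‖v‖ + ‖x‖) ^ 2)) ^ D) := by
  unfold extrapFun
  have hF : Differentiable ℂ (thetaEval L L' κM P) := fun w => (analyticAt_thetaEval L L' κM P w).differentiableAt
  have hdiff : Differentiable ℂ (fun ξ : ℂ => thetaEval L L' κM P (z • v + ξ • x)) :=
    hF.comp ((differentiable_const _).add (differentiable_id.smul_const x))
  have hbound : ∀ ξ ∈ sphere (0 : ℂ) 1, ‖thetaEval L L' κM P (z • v + ξ • x)‖ ≤
      Nesterenko.l1Norm P * Real.exp (C * (1 + (‖z‖ * ‖v‖ + ‖x‖) ^ 2)) ^ D := by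
    intro ξ hξ
    have hξ1 : ‖ξ‖ = 1 := by simpa using hξ
    refine (norm_thetaEval_le L L' κM hC0 hC hP _).trans ?_
    have hw : ‖z • v + ξ • x‖ ≤ ‖z‖ * ‖v‖ + ‖x‖ := by
      refine (norm_add_le _ _).trans (add_le_add ?_ ?_)
      · exact (norm_smul_le z v)
      · rw [norm_smul, hξ1, one_mul]
    have hexp : Real.exp (C * (1 + ‖z • v + ξ • x‖ ^ 2)) ≤ Real.exp (C * (1 + (‖z‖ * ‖v‖ + ‖x‖) ^ 2)) := by
      refine Real.exp_le_exp.mpr (mul_le_mul_of_nonneg_left ?_ hC0)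
      have := pow_le_pow_left₀ (norm_nonneg _) hw 2
      linarith
    exact mul_le_mul_of_nonneg_left (pow_le_pow_left₀ (Real.exp_nonneg _) hexp D) (Nesterenko.l1Norm_nonneg P)
  have h := Complex.norm_iteratedDeriv_le_of_forall_mem_sphere_norm_le (c := 0) (R := 1) k one_pos
    hdiff.diffContOnCl hbound
  simpa using h


/-- **Cauchy with an adapted radius.** For `r > 0`:
`|φ_{x,k}(z)| ≤ k! · ‖P‖₁ · e^{C(1 + (‖z‖‖v‖ + r‖x‖)²)·D} / r^k`. [cite: Baker1975, Ch. 2 Lemma 4] -/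
theorem norm_extrapFun_le_radius {C : ℝ} (hC0 : 0 ≤ C)
    (hC : ∀ (J : Option β × ThetaIdx (γ ⊕ γ') δ) (w : β ⊕ ((γ ⊕ γ') ⊕ δ) → ℂ), ‖theta L L' κM J w‖ ≤ Real.exp (C * (1 + ‖w‖ ^ 2)))
    {P : MvPolynomial (Option β × ThetaIdx (γ ⊕ γ') δ) ℂ} {D : ℕ} (hP : P.totalDegree ≤ D)
    (v x : β ⊕ ((γ ⊕ γ') ⊕ δ) → ℂ) (k : ℕ) (z : ℂ) {r : ℝ} (hr : 0 < r) :
    ‖extrapFun L L' κM P v x k z‖ ≤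
      k.factorial * (Nesterenko.l1Norm P * Real.exp (C * (1 + (‖z‖ * ‖v‖ + r * ‖x‖) ^ 2)) ^ D) / r ^ k := by
  unfold extrapFun
  have hF : Differentiable ℂ (thetaEval L L' κM P) := fun w => (analyticAt_thetaEval L L' κM P w).differentiableAt
  have hdiff : Differentiable ℂ (fun ξ : ℂ => thetaEval L L' κM P (z • v + ξ • x)) :=
    hF.comp ((differentiable_const _).add (differentiable_id.smul_const x))
  have hbound : ∀ ξ ∈ sphere (0 : ℂ) r, ‖thetaEval L L' κM P (z • v + ξ • x)‖ ≤
      Nesterenko.l1Norm P * Real.exp (C * (1 + (‖z‖ * ‖v‖ + r * ‖x‖) ^ 2)) ^ D := by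
    intro ξ hξ
    have hξ1 : ‖ξ‖ = r := by simpa using hξ
    refine (norm_thetaEval_le L L' κM hC0 hC hP _).trans ?_
    have hw : ‖z • v + ξ • x‖ ≤ ‖z‖ * ‖v‖ + r * ‖x‖ := by
      refine (norm_add_le _ _).trans (add_le_add ?_ ?_)
      · exact (norm_smul_le z v)
      · rw [norm_smul, hξ1]
    have hexp : Real.exp (C * (1 + ‖z • v + ξ • x‖ ^ 2)) ≤ Real.exp (C * (1 + (‖z‖ * ‖v‖ + r * ‖x‖) ^ 2)) := by
      refine Real.exp_le_exp.mpr (mul_le_mul_of_nonneg_left ?_ hC0)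
      have := pow_le_pow_left₀ (norm_nonneg _) hw 2
      linarith
    exact mul_le_mul_of_nonneg_left (pow_le_pow_left₀ (Real.exp_nonneg _) hexp D) (Nesterenko.l1Norm_nonneg P)
  exact Complex.norm_iteratedDeriv_le_of_forall_mem_sphere_norm_le (c := 0) k hr hdiff.diffContOnCl hbound


/-! ### The growth constant -/

/-- **The theta growth constant** `C_Θ ≥ 0`: `|Θ_J(w)| ≤ e^{C_Θ(1 + ‖w‖²)}`. [folklore] -/
def thetaGrowthC : ℝ := (exists_norm_theta_le (L := L) (L' := L') (κM := κM) (β := β)).choose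


/-- The defining property of `C_Θ`. [folklore] -/
theorem thetaGrowthC_spec : 0 ≤ thetaGrowthC (β := β) L L' κM ∧
    ∀ (J : Option β × ThetaIdx (γ ⊕ γ') δ) (w : β ⊕ ((γ ⊕ γ') ⊕ δ) → ℂ),
      ‖theta L L' κM J w‖ ≤ Real.exp (thetaGrowthC (β := β) L L' κM * (1 + ‖w‖ ^ 2)) :=
  (exists_norm_theta_le (L := L) (L' := L') (κM := κM) (β := β)).choose_spec


end Extrap

/-! ### Baker data: lower bound for the base theta, point step, extrapolation bounds, new points, the engine -/

section Engine

open Finset NumberField Metric Set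

namespace BakerData

variable (B : BakerData β γ γ' δ)

/-- **Per-factor lower bound.** For each `E`-factor `b` there are `c > 0`, `C ≥ 0` with
`c·e^{-C(1+s²)} ≤ |P_{i_b(s)}(s·z_b)|` for all `s ∈ ℕ`, where `i_b(s) = 2` if `s z_b ∈ Λ` (chart at
the origin) and `0` otherwise. [folklore] -/
theorem exists_univExtP_base_ge (b : γ ⊕ γ') : ∃ c : ℝ, 0 < c ∧ ∃ C : ℝ, 0 ≤ C ∧ ∀ s : ℕ,
    c * Real.exp (-(C * (1 + (s : ℝ) ^ 2))) ≤
      ‖(lat B.L B.L' b).univExtP (baseFin (B.cAt s b)) ((s : ℂ) * B.v (iz b))‖ := by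
  classical
  set z : ℂ := B.v (iz b) with hz
  have hN0 : 0 < B.N := B.hN
  set lam : ℂ := (B.tc.m b : ℂ) * (lat B.L B.L' b).ω₁ + (B.tc.n b : ℂ) * (lat B.L B.L' b).ω₂ with hlam
  have hNz : (B.N : ℂ) * z = lam := B.tc.eq b
  -- lattice coordinates of the `r z ∈ Λ`
  have hco : ∀ r : ℕ, ∃ ac : ℤ × ℤ, ((r : ℂ) * z ∈ (lat B.L B.L' b).lattice → (ac.1 : ℂ) * (lat B.L B.L' b).ω₁ + (ac.2 : ℂ) * (lat B.L B.L' b).ω₂ = (r : ℂ) * z) := by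
    intro r
    by_cases h : (r : ℂ) * z ∈ (lat B.L B.L' b).lattice
    · obtain ⟨m, n, hmn⟩ := PeriodPair.mem_lattice.mp h
      exact ⟨(m, n), fun _ => hmn⟩
    · exact ⟨(0, 0), fun h' => absurd h' h⟩
  choose ac hac using hco
  -- constants
  set Aη : ℝ := ∑ r ∈ Finset.range B.N, ‖((ac r).1 : ℂ) * (lat B.L B.L' b).η₁ + ((ac r).2 : ℂ) * (lat B.L B.L' b).η₂‖ with hAη
  set Hη : ℝ := ‖(B.tc.m b : ℂ) * (lat B.L B.L' b).η₁ + (B.tc.n b : ℂ) * (lat B.L B.L' b).η₂‖ with hHη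
  have hAη0 : 0 ≤ Aη := Finset.sum_nonneg fun _ _ => norm_nonneg _
  have hHη0 : 0 ≤ Hη := norm_nonneg _
  set μf : ℕ → ℝ := fun r => if (r : ℂ) * z ∈ (lat B.L B.L' b).lattice then 1 else ‖(lat B.L B.L' b).weierstrassSigma ((r : ℂ) * z)‖ with hμf
  have hne : (Finset.range B.N).Nonempty := ⟨0, Finset.mem_range.mpr hN0⟩
  set μ : ℝ := (Finset.range B.N).inf' hne μf with hμ
  have hμpos : 0 < μ := by
    rw [hμ, Finset.lt_inf'_iff]
    intro r _
    simp only [hμf]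
    split_ifs with h
    · exact one_pos
    · exact norm_pos_iff.mpr ((lat B.L B.L' b).weierstrassSigma_ne_zero h)
  have hμle : ∀ r < B.N, (r : ℂ) * z ∉ (lat B.L B.L' b).lattice → μ ≤ ‖(lat B.L B.L' b).weierstrassSigma ((r : ℂ) * z)‖ := by
    intro r hr hnot
    have := Finset.inf'_le μf (Finset.mem_range.mpr hr)
    simp only [hμf, if_neg hnot] at this
    rw [hμ]; exact this
  set Clat : ℝ := 3 / 2 * ‖z‖ * (Aη + Hη) with hClat
  set Cgen : ℝ := Hη * (B.N * ‖z‖ + ‖lam‖ / 2) * 2 with hCgen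
  refine ⟨min 2 (μ ^ 3), lt_min two_pos (pow_pos hμpos 3), max Clat (3 * Cgen),
    le_max_of_le_left (by rw [hClat]; exact mul_nonneg (mul_nonneg (by norm_num) (norm_nonneg _)) (add_nonneg hAη0 hHη0)),
    fun s => ?_⟩
  -- `s = qN + r`
  set q := s / B.N with hq
  set r := s % B.N with hr
  have hs : s = q * B.N + r := by rw [hq, hr, Nat.div_add_mod' s B.N]
  have hrN : r < B.N := Nat.mod_lt s hN0
  have hqs : (q : ℝ) ≤ s := by exact_mod_cast Nat.div_le_self s B.N
  have hs0 : (0 : ℝ) ≤ s := Nat.cast_nonneg s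
  have hdecomp : (s : ℂ) * z = (r : ℂ) * z + (((q * B.tc.m b : ℤ) : ℂ) * (lat B.L B.L' b).ω₁ + ((q * B.tc.n b : ℤ) : ℂ) * (lat B.L B.L' b).ω₂) := by
    have := B.tc.mul_coord q r b
    rw [← hs] at this
    simpa [hz] using this
  -- generic bound on `e^{-C(1+s²)}` monotonicity
  have hexp_mono : ∀ {C C' : ℝ}, C ≤ C' → Real.exp (-(C' * (1 + (s : ℝ) ^ 2))) ≤ Real.exp (-(C * (1 + (s : ℝ) ^ 2))) :=
    fun h => Real.exp_le_exp.mpr (neg_le_neg (mul_le_mul_of_nonneg_right h (by positivity)))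
  have hcAt : B.cAt s b = (if (s : ℂ) * z ∈ (lat B.L B.L' b).lattice then true else false) := by
    simp [BakerData.cAt, chartChoiceAt, hz]
  by_cases hmem : (s : ℂ) * z ∈ (lat B.L B.L' b).lattice
  · -- chart at the origin: `P₂(s z)`, `s z = (a_r + q m) ω₁ + (c_r + q n) ω₂`
    have hrmem : (r : ℂ) * z ∈ (lat B.L B.L' b).lattice := by
      have h2 : (r : ℂ) * z = (s : ℂ) * z - (((q * B.tc.m b : ℤ) : ℂ) * (lat B.L B.L' b).ω₁ + ((q * B.tc.n b : ℤ) : ℂ) * (lat B.L B.L' b).ω₂) := by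
        rw [hdecomp]; ring
      rw [h2]
      exact sub_mem hmem ((lat B.L B.L' b).int_mul_add_int_mul_mem_lattice _ _)
    have hcoord := hac r hrmem
    set M₁ : ℤ := (ac r).1 + q * B.tc.m b with hM₁
    set M₂ : ℤ := (ac r).2 + q * B.tc.n b with hM₂
    have hsz : (s : ℂ) * z = (M₁ : ℂ) * (lat B.L B.L' b).ω₁ + (M₂ : ℂ) * (lat B.L B.L' b).ω₂ := by
      rw [hdecomp, ← hcoord, hM₁, hM₂]; push_cast; ring
    have hbase : baseFin (B.cAt s b) = 2 := by rw [hcAt, if_pos hmem]; rfl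
    rw [hbase, hsz, (lat B.L B.L' b).norm_univExtP_two_lattice M₁ M₂]
    -- the exponent
    have hη : ‖(M₁ : ℂ) * (lat B.L B.L' b).η₁ + (M₂ : ℂ) * (lat B.L B.L' b).η₂‖ ≤ Aη + s * Hη := by
      have e1 : (M₁ : ℂ) * (lat B.L B.L' b).η₁ + (M₂ : ℂ) * (lat B.L B.L' b).η₂ =
          (((ac r).1 : ℂ) * (lat B.L B.L' b).η₁ + ((ac r).2 : ℂ) * (lat B.L B.L' b).η₂) + (q : ℂ) * ((B.tc.m b : ℂ) * (lat B.L B.L' b).η₁ + (B.tc.n b : ℂ) * (lat B.L B.L' b).η₂) := by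
        rw [hM₁, hM₂]; push_cast; ring
      rw [e1]
      refine (norm_add_le _ _).trans (add_le_add ?_ ?_)
      · exact Finset.single_le_sum (f := fun r => ‖((ac r).1 : ℂ) * (lat B.L B.L' b).η₁ + ((ac r).2 : ℂ) * (lat B.L B.L' b).η₂‖)
          (fun _ _ => norm_nonneg _) (Finset.mem_range.mpr hrN)
      · rw [norm_mul, Complex.norm_natCast]
        exact mul_le_mul_of_nonneg_right hqs hHη0
    have hlamn : ‖(M₁ : ℂ) * (lat B.L B.L' b).ω₁ + (M₂ : ℂ) * (lat B.L B.L' b).ω₂‖ = s * ‖z‖ := by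
      rw [← hsz, norm_mul, Complex.norm_natCast]
    have hre : -(Clat * (1 + (s : ℝ) ^ 2)) ≤
        3 * (((M₁ : ℂ) * (lat B.L B.L' b).η₁ + (M₂ : ℂ) * (lat B.L B.L' b).η₂) * (((M₁ : ℂ) * (lat B.L B.L' b).ω₁ + (M₂ : ℂ) * (lat B.L B.L' b).ω₂) / 2)).re := by
      have h1 := Complex.abs_re_le_norm (((M₁ : ℂ) * (lat B.L B.L' b).η₁ + (M₂ : ℂ) * (lat B.L B.L' b).η₂) * (((M₁ : ℂ) * (lat B.L B.L' b).ω₁ + (M₂ : ℂ) * (lat B.L B.L' b).ω₂) / 2))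
      have h2 := neg_abs_le (((M₁ : ℂ) * (lat B.L B.L' b).η₁ + (M₂ : ℂ) * (lat B.L B.L' b).η₂) * (((M₁ : ℂ) * (lat B.L B.L' b).ω₁ + (M₂ : ℂ) * (lat B.L B.L' b).ω₂) / 2)).re
      rw [norm_mul, norm_div, hlamn, Complex.norm_two] at h1
      have h3 : ‖(M₁ : ℂ) * (lat B.L B.L' b).η₁ + (M₂ : ℂ) * (lat B.L B.L' b).η₂‖ * (s * ‖z‖ / 2) ≤ (Aη + s * Hη) * (s * ‖z‖ / 2) :=
        mul_le_mul_of_nonneg_right hη (by positivity)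
      have h4 : (Aη + s * Hη) * (s * ‖z‖ / 2) * 3 ≤ Clat * (1 + (s : ℝ) ^ 2) := by
        have := lin_quad_le (a := Aη) (b := Hη) hAη0 hHη0 s
        rw [hClat]
        nlinarith [norm_nonneg z]
      linarith
    calc min 2 (μ ^ 3) * Real.exp (-(max Clat (3 * Cgen) * (1 + (s : ℝ) ^ 2)))
        ≤ 2 * Real.exp (-(Clat * (1 + (s : ℝ) ^ 2))) :=
          mul_le_mul (min_le_left _ _) (hexp_mono (le_max_left _ _)) (Real.exp_nonneg _) zero_le_two
      _ ≤ 2 * Real.exp ((((M₁ : ℂ) * (lat B.L B.L' b).η₁ + (M₂ : ℂ) * (lat B.L B.L' b).η₂) * (((M₁ : ℂ) * (lat B.L B.L' b).ω₁ + (M₂ : ℂ) * (lat B.L B.L' b).ω₂) / 2)).re) ^ 3 := by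
          rw [← Real.exp_nat_mul]
          refine mul_le_mul_of_nonneg_left (Real.exp_le_exp.mpr ?_) zero_le_two
          push_cast
          linarith
  · -- generic chart: `P₀(s z) = σ(s z)³`, `σ(s z) = A·σ(r z)`
    have hrnot : (r : ℂ) * z ∉ (lat B.L B.L' b).lattice := by
      intro h
      apply hmem
      rw [hdecomp]
      exact add_mem h ((lat B.L B.L' b).int_mul_add_int_mul_mem_lattice _ _)
    have hbase : baseFin (B.cAt s b) = 0 := by rw [hcAt, if_neg hmem]; rfl
    obtain ⟨p0, -, -⟩ := PeriodPair.univExtP_eq (L := lat B.L B.L' b) hmem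
    rw [hbase, p0]
    rw [norm_pow]
    have hσ : (lat B.L B.L' b).weierstrassSigma ((s : ℂ) * z) =
        (lat B.L B.L' b).sigmaLatticeAut (q * B.tc.m b) (q * B.tc.n b) ((r : ℂ) * z) * (lat B.L B.L' b).weierstrassSigma ((r : ℂ) * z) := by
      rw [hdecomp]
      exact (lat B.L B.L' b).weierstrassSigma_add_lattice _ _ _
    rw [hσ, norm_mul]
    have hA := (lat B.L B.L' b).norm_sigmaLatticeAut_ge (q * B.tc.m b) (q * B.tc.n b) ((r : ℂ) * z)
    -- the exponent in the automorphy bound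
    have hexpo : ‖(((q * B.tc.m b : ℤ)) * (lat B.L B.L' b).η₁ + ((q * B.tc.n b : ℤ)) * (lat B.L B.L' b).η₂ : ℂ)‖ *
        (‖(r : ℂ) * z‖ + ‖(((q * B.tc.m b : ℤ)) * (lat B.L B.L' b).ω₁ + ((q * B.tc.n b : ℤ)) * (lat B.L B.L' b).ω₂ : ℂ)‖ / 2) ≤
        Cgen * (1 + (s : ℝ) ^ 2) := by
      have e1 : (((q * B.tc.m b : ℤ)) * (lat B.L B.L' b).η₁ + ((q * B.tc.n b : ℤ)) * (lat B.L B.L' b).η₂ : ℂ) =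
          (q : ℂ) * ((B.tc.m b : ℂ) * (lat B.L B.L' b).η₁ + (B.tc.n b : ℂ) * (lat B.L B.L' b).η₂) := by push_cast; ring
      have e2 : (((q * B.tc.m b : ℤ)) * (lat B.L B.L' b).ω₁ + ((q * B.tc.n b : ℤ)) * (lat B.L B.L' b).ω₂ : ℂ) = (q : ℂ) * lam := by
        rw [hlam]; push_cast; ring
      rw [e1, e2, norm_mul, norm_mul, Complex.norm_natCast, Complex.norm_natCast, norm_mul, Complex.norm_natCast]
      have hrz : (r : ℝ) * ‖z‖ ≤ B.N * ‖z‖ :=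
        mul_le_mul_of_nonneg_right (by exact_mod_cast hrN.le) (norm_nonneg _)
      have hq0 : (0 : ℝ) ≤ q := Nat.cast_nonneg q
      calc (q : ℝ) * Hη * ((r : ℝ) * ‖z‖ + (q : ℝ) * ‖lam‖ / 2)
          ≤ (q : ℝ) * Hη * (B.N * ‖z‖ + (s : ℝ) * ‖lam‖ / 2) := by
            refine mul_le_mul_of_nonneg_left (add_le_add hrz ?_) (by positivity)
            exact div_le_div_of_nonneg_right (mul_le_mul_of_nonneg_right hqs (norm_nonneg _)) zero_le_two
        _ ≤ (s : ℝ) * Hη * (B.N * ‖z‖ + (s : ℝ) * ‖lam‖ / 2) :=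
            mul_le_mul_of_nonneg_right (mul_le_mul_of_nonneg_right hqs hHη0) (by positivity)
        _ = (Hη * (B.N * ‖z‖)) * s + (Hη * (‖lam‖ / 2)) * (s : ℝ) ^ 2 := by ring
        _ ≤ (Hη * (B.N * ‖z‖) + Hη * (‖lam‖ / 2)) * (1 + (s : ℝ) ^ 2) :=
            lin_quad_le (by positivity) (by positivity) s
        _ ≤ Cgen * (1 + (s : ℝ) ^ 2) := by
            refine mul_le_mul_of_nonneg_right ?_ (by positivity)
            rw [hCgen]
            have hX : 0 ≤ Hη * (B.N * ‖z‖ + ‖lam‖ / 2) := by positivity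
            have e3 : Hη * (B.N * ‖z‖) + Hη * (‖lam‖ / 2) = Hη * (B.N * ‖z‖ + ‖lam‖ / 2) := by ring
            rw [e3]; linarith
    have hAut : Real.exp (-(Cgen * (1 + (s : ℝ) ^ 2))) ≤
        ‖(lat B.L B.L' b).sigmaLatticeAut (q * B.tc.m b) (q * B.tc.n b) ((r : ℂ) * z)‖ := by
      refine le_trans (Real.exp_le_exp.mpr ?_) hA
      push_cast at hexpo ⊢
      linarith
    have hσr := hμle r hrN hrnot
    calc min 2 (μ ^ 3) * Real.exp (-(max Clat (3 * Cgen) * (1 + (s : ℝ) ^ 2)))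
        ≤ μ ^ 3 * Real.exp (-(3 * Cgen * (1 + (s : ℝ) ^ 2))) :=
          mul_le_mul (min_le_right _ _) (hexp_mono (le_max_right _ _)) (Real.exp_nonneg _) (pow_nonneg hμpos.le 3)
      _ = (Real.exp (-(Cgen * (1 + (s : ℝ) ^ 2))) * μ) ^ 3 := by
          rw [mul_pow, ← Real.exp_nat_mul]; push_cast; ring_nf
      _ ≤ (‖(lat B.L B.L' b).sigmaLatticeAut (q * B.tc.m b) (q * B.tc.n b) ((r : ℂ) * z)‖ * ‖(lat B.L B.L' b).weierstrassSigma ((r : ℂ) * z)‖) ^ 3 :=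
          pow_le_pow_left₀ (by positivity) (mul_le_mul hAut hσr hμpos.le (norm_nonneg _)) 3


/-- **Lower bound for the base theta function at the points `s·v`.** There are `c > 0` and
`C ≥ 0`, depending only on the data, with `c·e^{-C(1+s²)} ≤ |Θ_{J₀(c_s)}(s·v)|` for all `s ∈ ℕ`.
[cite: BakerWustholz2007, §6.8 (p. 119)] -/
theorem exists_theta_baseIdx_ge : ∃ c : ℝ, 0 < c ∧ ∃ C : ℝ, 0 ≤ C ∧ ∀ s : ℕ,
    c * Real.exp (-(C * (1 + (s : ℝ) ^ 2))) ≤ ‖theta B.L B.L' B.κM (baseIdx (B.cAt s)) ((s : ℂ) • B.v)‖ := by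
  choose c hc C hC h using fun b => B.exists_univExtP_base_ge b
  refine ⟨∏ b, c b, Finset.prod_pos fun b _ => hc b, ∑ b, C b, Finset.sum_nonneg fun b _ => hC b, fun s => ?_⟩
  rw [theta_baseIdx, norm_prod]
  have e : (∏ b, c b) * Real.exp (-((∑ b, C b) * (1 + (s : ℝ) ^ 2))) =
      ∏ b, c b * Real.exp (-(C b * (1 + (s : ℝ) ^ 2))) := by
    rw [Finset.prod_mul_distrib, ← Real.exp_sum]
    congr 1
    rw [Finset.sum_mul, ← Finset.sum_neg_distrib]
  rw [e]
  refine Finset.prod_le_prod (fun b _ => by have := hc b; positivity) fun b _ => ?_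
  simpa [Pi.smul_apply, smul_eq_mul] using h b s


/-- **The spaced Siegel matrix**: the row `(s₀, α)` is the row of the sharp system at the point
index `ℓ s₀`, i.e. `d_{ℓs₀}^{E(D,|α|)} · ∑_{content α} entryVal (ℓ s₀)` when `|α| < T`, and zero
otherwise. [cite: BakerWustholz2007, §6.8 (pp. 117–118)] -/
def sMat₃ (ℓ D' T S₀ : ℕ) : Matrix (B.EIdx₂ T S₀) (UIdx β (γ ⊕ γ') δ D') (𝓞 B.K) := fun r u =>
  if B.rowOrder r.2 < T then
    ⟨(B.dAt (ℓ * r.1) : B.K) ^ B.expE (Fintype.card (β ⊕ ((γ ⊕ γ') ⊕ δ)) * D') (B.rowOrder r.2) *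
        B.rowSum (Fintype.card (β ⊕ ((γ ⊕ γ') ⊕ δ)) * D') (ℓ * r.1) (B.rowOrder r.2) r.2 (νOf u),
      B.isIntegral_rowSum _ _ _ _ (degree_νOf_le u)⟩
  else 0


/-- The entries of the spaced matrix have house `≤ houseBound D' T (ℓ S₀)` (they are entries of
the matrix of `SiegelSystem.lean` with `ℓ S₀` in place of `S₀`, or zero). [folklore] -/
theorem house_sMat₃_le (ℓ D' T S₀ : ℕ) (r : B.EIdx₂ T S₀) (u : UIdx β (γ ⊕ γ') δ D') :
    house ((B.sMat₃ ℓ D' T S₀ r u : 𝓞 B.K) : B.K) ≤ B.houseBound D' T (ℓ * S₀) := by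
  unfold sMat₃
  split_ifs with h
  · have hlt : ℓ * (r.1 : ℕ) < ℓ * S₀ + 1 :=
      Nat.lt_succ_of_le (Nat.mul_le_mul_left ℓ (Nat.lt_succ_iff.mp r.1.isLt))
    have := B.house_sMat_le D' T (ℓ * S₀) (⟨ℓ * r.1, hlt⟩, ⟨B.rowOrder r.2, h⟩, r.2) u
    simpa [sMat] using this
  · have h0 : house ((0 : 𝓞 B.K) : B.K) = 0 := by simp [house]
    rw [h0]
    exact zero_le_one.trans (B.one_le_houseBound D' T (ℓ * S₀))


variable [DecidableEq β] [DecidableEq δ]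

/-- The analytic subgroup direction space `𝔟 = ⟨x_1, …, x_dd⟩`. [folklore] -/
abbrev bSpan : Submodule ℂ (β ⊕ ((γ ⊕ γ') ⊕ δ) → ℂ) := Submodule.span ℂ (Set.range B.xs)


/-- The grid directions `x_c = ∑ c_m x_m`. [folklore] -/
def gridDir (cg : Fin B.dd → ℕ) : β ⊕ ((γ ⊕ γ') ⊕ δ) → ℂ := ∑ m, (cg m : ℂ) • B.xs m


omit [DecidableEq β] [DecidableEq δ] in
/-- Grid directions lie in `𝔟`. [folklore] -/
theorem gridDir_mem (cg : Fin B.dd → ℕ) : B.gridDir cg ∈ B.bSpan :=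
  Submodule.sum_mem _ fun m _ => Submodule.smul_mem _ _ (Submodule.subset_span ⟨m, rfl⟩)


/-- The auxiliary form attached to `ξ`: `P = homog (nD') (QOf ξ)`. [folklore] -/
abbrev auxForm {D' : ℕ} (ξ : UIdx β (γ ⊕ γ') δ D' → 𝓞 B.K) : MvPolynomial (Option β × ThetaIdx (γ ⊕ γ') δ) ℂ :=
  homog (Fintype.card (β ⊕ ((γ ⊕ γ') ⊕ δ)) * D') (B.QOf ξ)


/-- **Lower levels give vanishing along `𝔟`.** If `p_{s,k'} = 0` for all `k' < k` then `F_P`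
vanishes to order `≥ k` along `𝔟` at `s·v`. [folklore] -/
theorem vanishesAlong_of_levels {D' : ℕ} (ξ : UIdx β (γ ⊕ γ') δ D' → 𝓞 B.K) (s : ℕ) {k : ℕ}
    (h : ∀ k' < k, B.lineValPoly ξ s k' = 0) :
    VanishesAlong B.bSpan (thetaEval B.L B.L' B.κM (B.auxForm ξ)) ((s : ℂ) • B.v) k := by
  refine vanishesAlong_span_of_wordForms B.L B.L' B.κM (isHomogeneous_homog _ _) (B.cAt s)
    (fun x => zero_mem_chartDomain_chartChoiceAt B.L B.L' _ x) B.xs k fun k' hk' α => ?_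
  have e := B.emb_coeff_lineValPoly ξ s k' (fun m => (α m : ℕ))
  rw [h k' hk', coeff_zero, map_zero] at e
  exact e.symm


/-- **The inductive step at a new point.** Let `s ∈ ℕ`, `T'`, and suppose that for every
`k < T'` and every grid direction `x_c` (`c_m ≤ k`) the extrapolation function satisfies
`|φ_{x_c,k}(s)| · |d_s|^{E} · (|d_s|^{E}·lineValBound)^{h-1} < |Θ_{J₀(c_s)}(s·v)|^D`. Then `F_P`
vanishes to order `≥ T'` along `𝔟` at `s·v`. [cite: BakerWustholz2007, §6.8 (p. 119)] -/
theorem vanishesAlong_of_small {D' : ℕ} (ξ : UIdx β (γ ⊕ γ') δ D' → 𝓞 B.K) (s T' : ℕ)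
    (hφ : ∀ k < T', ∀ cg : Fin B.dd → ℕ, (∀ m, cg m ≤ k) →
      ‖extrapFun B.L B.L' B.κM (B.auxForm ξ) B.v (B.gridDir cg) k s‖ *
        (|(B.dAt s : ℝ)| ^ B.expE (Fintype.card (β ⊕ ((γ ⊕ γ') ⊕ δ)) * D') k *
          (|(B.dAt s : ℝ)| ^ B.expE (Fintype.card (β ⊕ ((γ ⊕ γ') ⊕ δ)) * D') k * B.lineValBound ξ s k) ^
            (B.gens.h - 1)) <
        ‖theta B.L B.L' B.κM (baseIdx (B.cAt s)) ((s : ℂ) • B.v)‖ ^ (Fintype.card (β ⊕ ((γ ⊕ γ') ⊕ δ)) * D')) :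
    VanishesAlong B.bSpan (thetaEval B.L B.L' B.κM (B.auxForm ξ)) ((s : ℂ) • B.v) T' := by
  set D := Fintype.card (β ⊕ ((γ ⊕ γ') ⊕ δ)) * D' with hD
  -- all levels below `T'` vanish, by strong induction
  have hlev : ∀ k < T', B.lineValPoly ξ s k = 0 := by
    intro k
    induction k using Nat.strong_induction_on with
    | _ k ih =>
      intro hk
      have hvan : VanishesAlong B.bSpan (thetaEval B.L B.L' B.κM (B.auxForm ξ)) ((s : ℂ) • B.v) k :=
        B.vanishesAlong_of_levels ξ s fun k' hk' => ih k' hk' (hk'.trans hk)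
      -- every grid value vanishes
      have hgrid : ∀ cg : Fin B.dd → ℕ, (∀ m, cg m ≤ k) →
          MvPolynomial.eval (fun m => (cg m : B.K)) (B.lineValPoly ξ s k) = 0 := by
        intro cg hcg
        have hlow : ∀ i < k, iteratedDeriv i (fun t : ℂ => thetaEval B.L B.L' B.κM (B.auxForm ξ)
            ((s : ℂ) • B.v + t • ∑ m, (cg m : ℂ) • B.xs m)) 0 = 0 :=
          fun i hi => hvan _ (B.gridDir_mem cg) i hi
        have hval := B.iteratedDeriv_grid_eq ξ s k cg hlow
        have hsmall := hφ k hk cg hcg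
        -- `φ = Θ₀^D · emb p`
        have hφeq : extrapFun B.L B.L' B.κM (B.auxForm ξ) B.v (B.gridDir cg) k s =
            theta B.L B.L' B.κM (baseIdx (B.cAt s)) ((s : ℂ) • B.v) ^ D *
              B.emb (MvPolynomial.eval (fun m => (cg m : B.K)) (B.lineValPoly ξ s k)) := hval
        rw [hφeq, norm_mul, norm_pow, mul_assoc] at hsmall
        have hΘ : 0 < ‖theta B.L B.L' B.κM (baseIdx (B.cAt s)) ((s : ℂ) • B.v)‖ ^ D := by
          obtain ⟨c, hc, C, -, hge⟩ := B.exists_theta_baseIdx_ge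
          exact pow_pos (lt_of_lt_of_le (by have := hge s; positivity) (hge s)) D
        refine B.lineVal_eq_zero_of_norm_lt ξ s k hcg ?_
        have := (mul_lt_iff_lt_one_right hΘ).mp hsmall
        rw [← hD, mul_assoc]
        exact this
      -- the grid lemma
      refine MvPolynomial.eq_zero_of_eval_zero_at_prod_finset _
        (fun _ => (Finset.range (k + 1)).image (fun j : ℕ => (j : B.K))) (fun m => ?_) (fun x hx => ?_)
      · rw [Finset.card_image_of_injective _ Nat.cast_injective, Finset.card_range]
        exact Nat.lt_succ_of_le (B.degreeOf_lineValPoly_le ξ s k m)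
      · have hx' : ∀ m, ∃ j : ℕ, j ≤ k ∧ (j : B.K) = x m := fun m => by
          obtain ⟨j, hj, hjx⟩ := Finset.mem_image.mp (hx m)
          exact ⟨j, Nat.lt_succ_iff.mp (Finset.mem_range.mp hj), hjx⟩
        choose cg hcg hcgx using hx'
        have hxe : x = fun m => (cg m : B.K) := funext fun m => (hcgx m).symm
        rw [hxe]
        exact hgrid cg hcg
  exact B.vanishesAlong_of_levels ξ s hlev


/-- `‖homog D (QOf ξ)‖₁ ≤ ∑_u |ξ_u|`. [folklore] -/
theorem l1Norm_homog_QOf_le {D' : ℕ} (ξ : UIdx β (γ ⊕ γ') δ D' → 𝓞 B.K) :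
    Nesterenko.l1Norm (B.auxForm ξ) ≤ ∑ u, ‖B.emb ((ξ u : 𝓞 B.K) : B.K)‖ := by
  unfold Nesterenko.l1Norm auxForm
  rw [homog_QOf]
  -- `coeff_J (∑_u C a_u * m_u) = ∑_u a_u * coeff_J m_u` and `∑_J |coeff_J m_u| = 1`
  set D := Fintype.card (β ⊕ ((γ ⊕ γ') ⊕ δ)) * D' with hD
  have hmon : ∀ u : UIdx β (γ ⊕ γ') δ D', ∃ J : (Option β × ThetaIdx (γ ⊕ γ') δ) →₀ ℕ,
      (homogMonomialᵣ D (νOf u) : MvPolynomial (Option β × ThetaIdx (γ ⊕ γ') δ) ℂ) = monomial J 1 := by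
    intro u
    refine ⟨Finsupp.single (baseIdx (genericChart (γ := γ ⊕ γ'))) (D - (νOf u).degree) + (νOf u).mapDomain affIdx, ?_⟩
    rw [homogMonomialᵣ, X_pow_eq_monomial, monomial_mul, one_mul]
  choose J hJ using hmon
  have hsum : (∑ u, C (B.emb ((ξ u : 𝓞 B.K) : B.K)) * homogMonomialᵣ D (νOf u) :
      MvPolynomial (Option β × ThetaIdx (γ ⊕ γ') δ) ℂ) = ∑ u, monomial (J u) (B.emb ((ξ u : 𝓞 B.K) : B.K)) := by
    refine Finset.sum_congr rfl fun u _ => ?_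
    rw [hJ u, C_mul_monomial, mul_one]
  rw [hsum]
  -- bound the ℓ¹ norm of a sum of monomials
  calc ∑ I ∈ (∑ u, monomial (J u) (B.emb ((ξ u : 𝓞 B.K) : B.K))).support,
        ‖coeff I (∑ u, monomial (J u) (B.emb ((ξ u : 𝓞 B.K) : B.K)))‖
      ≤ ∑ I ∈ (∑ u, monomial (J u) (B.emb ((ξ u : 𝓞 B.K) : B.K))).support,
          ∑ u, ‖coeff I (monomial (J u) (B.emb ((ξ u : 𝓞 B.K) : B.K)))‖ := by
        refine Finset.sum_le_sum fun I _ => ?_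
        rw [coeff_sum]
        exact norm_sum_le _ _
    _ = ∑ u, ∑ I ∈ (∑ u, monomial (J u) (B.emb ((ξ u : 𝓞 B.K) : B.K))).support,
          ‖coeff I (monomial (J u) (B.emb ((ξ u : 𝓞 B.K) : B.K)))‖ := Finset.sum_comm
    _ ≤ ∑ u, ‖B.emb ((ξ u : 𝓞 B.K) : B.K)‖ := by
        refine Finset.sum_le_sum fun u _ => ?_
        by_cases hmem : J u ∈ (∑ u, monomial (J u) (B.emb ((ξ u : 𝓞 B.K) : B.K))).support
        · rw [← Finset.add_sum_erase _ _ hmem, coeff_monomial, if_pos rfl]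
          have : ∑ I ∈ ((∑ u, monomial (J u) (B.emb ((ξ u : 𝓞 B.K) : B.K))).support).erase (J u),
              ‖coeff I (monomial (J u) (B.emb ((ξ u : 𝓞 B.K) : B.K)))‖ = 0 := by
            refine Finset.sum_eq_zero fun I hI => ?_
            rw [coeff_monomial, if_neg (Finset.ne_of_mem_erase hI).symm, norm_zero]
          rw [this, add_zero]
        · have h0 : ∑ I ∈ (∑ u, monomial (J u) (B.emb ((ξ u : 𝓞 B.K) : B.K))).support,
              ‖coeff I (monomial (J u) (B.emb ((ξ u : 𝓞 B.K) : B.K)))‖ = 0 :=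
            Finset.sum_eq_zero fun I hI => by
              rw [coeff_monomial, if_neg (fun h => hmem (by rw [h]; exact hI)), norm_zero]
          rw [h0]; exact norm_nonneg _


/-- `∑_u |ξ_u| ≤ #U · H_ξ`. [folklore] -/
theorem sum_norm_xi_le {D' : ℕ} (ξ : UIdx β (γ ⊕ γ') δ D' → 𝓞 B.K) :
    ∑ u, ‖B.emb ((ξ u : 𝓞 B.K) : B.K)‖ ≤ Fintype.card (UIdx β (γ ⊕ γ') δ D') * B.houseXi ξ := by
  calc ∑ u, ‖B.emb ((ξ u : 𝓞 B.K) : B.K)‖ ≤ ∑ _u : UIdx β (γ ⊕ γ') δ D', B.houseXi ξ :=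
        Finset.sum_le_sum fun u _ => B.norm_embedding_xi_le ξ B.emb u
    _ = Fintype.card (UIdx β (γ ⊕ γ') δ D') * B.houseXi ξ := by rw [Finset.sum_const, nsmul_eq_mul, Finset.card_univ]


/-- The size of the directions `X = ∑_m ‖x_m‖`. [folklore] -/
def dirNorm : ℝ := ∑ m, ‖B.xs m‖


omit [DecidableEq β] [DecidableEq δ] in
/-- `0 ≤ X`. [folklore] -/
theorem dirNorm_nonneg : 0 ≤ B.dirNorm := Finset.sum_nonneg fun _ _ => norm_nonneg _


omit [DecidableEq β] [DecidableEq δ] in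
/-- `‖x_c‖ ≤ k · X` for `c_m ≤ k`. [folklore] -/
theorem norm_gridDir_le {k : ℕ} {cg : Fin B.dd → ℕ} (hcg : ∀ m, cg m ≤ k) :
    ‖B.gridDir cg‖ ≤ k * B.dirNorm := by
  unfold gridDir dirNorm
  rw [Finset.mul_sum]
  refine (norm_sum_le _ _).trans (Finset.sum_le_sum fun m _ => ?_)
  rw [norm_smul, Complex.norm_natCast]
  exact mul_le_mul_of_nonneg_right (by exact_mod_cast hcg m) (norm_nonneg _)


/-- **The extrapolation estimate.** Suppose `v ∈ 𝔟`, `F_P` vanishes to order `≥ T` along `𝔟` at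
`0, v, …, S₀v`, `c_m ≤ k`, and `R ≥ 2(s + S₀)`, `R > 0`. Then, with the theta growth
constant `C`,
`|φ_{x_c,k}(s)| ≤ k!·#U·H_ξ·e^{C(1+(R‖v‖+kX)²)}^D·(2(s+S₀)/R)^{(T-k)(S₀+1)}`.
[cite: Baker1975, Ch. 2 Lemma 4; BakerWustholz2007, §6.8 (p. 119)] -/
theorem norm_extrapFun_grid_le {C : ℝ} (hC0 : 0 ≤ C)
    (hC : ∀ (J : Option β × ThetaIdx (γ ⊕ γ') δ) (w : β ⊕ ((γ ⊕ γ') ⊕ δ) → ℂ),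
      ‖theta B.L B.L' B.κM J w‖ ≤ Real.exp (C * (1 + ‖w‖ ^ 2)))
    (hv : B.v ∈ B.bSpan) {D' : ℕ} (ξ : UIdx β (γ ⊕ γ') δ D' → 𝓞 B.K) {T S₀ : ℕ}
    (hvan : ∀ s₀ : ℕ, s₀ ≤ S₀ → VanishesAlong B.bSpan (thetaEval B.L B.L' B.κM (B.auxForm ξ)) ((s₀ : ℂ) • B.v) T)
    {k : ℕ} {cg : Fin B.dd → ℕ} (hcg : ∀ m, cg m ≤ k) (s : ℕ) {R : ℝ} (hR0 : 0 < R)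
    (hR : 2 * ((s : ℝ) + S₀) ≤ R) :
    ‖extrapFun B.L B.L' B.κM (B.auxForm ξ) B.v (B.gridDir cg) k s‖ ≤
      k.factorial * (Fintype.card (UIdx β (γ ⊕ γ') δ D') * B.houseXi ξ *
        Real.exp (C * (1 + (R * ‖B.v‖ + k * B.dirNorm) ^ 2)) ^ (Fintype.card (β ⊕ ((γ ⊕ γ') ⊕ δ)) * D')) *
        (2 * ((s : ℝ) + S₀) / R) ^ ((T - k) * (S₀ + 1)) := by
  set D := Fintype.card (β ⊕ ((γ ⊕ γ') ⊕ δ)) * D' with hD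
  set f := extrapFun B.L B.L' B.κM (B.auxForm ξ) B.v (B.gridDir cg) k with hf
  set pts : Finset ℂ := (Finset.range (S₀ + 1)).image (fun j : ℕ => (j : ℂ)) with hpts
  have hcard : pts.card = S₀ + 1 := by
    rw [hpts, Finset.card_image_of_injective _ Nat.cast_injective, Finset.card_range]
  have hdiff : Differentiable ℂ f := differentiable_extrapFun B.L B.L' B.κM _ _ _ k
  -- orders at the points
  have hord : ∀ c ∈ pts, ((T - k : ℕ) : ℕ∞) ≤ analyticOrderAt f c := by
    intro c hc
    obtain ⟨j, hj, rfl⟩ := Finset.mem_image.mp hc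
    have hjS : j ≤ S₀ := Nat.lt_succ_iff.mp (Finset.mem_range.mp hj)
    exact le_analyticOrderAt_extrapFun B.L B.L' B.κM _ hv (B.gridDir_mem cg) (hvan j hjS) k
  -- the bound on the circle
  set θ : ℝ := k.factorial * (Nesterenko.l1Norm (B.auxForm ξ) *
    Real.exp (C * (1 + (R * ‖B.v‖ + ‖B.gridDir cg‖) ^ 2)) ^ D) with hθ
  have hθb : ∀ z ∈ sphere (0 : ℂ) R, ‖f z‖ ≤ θ := by
    intro z hz
    have hzR : ‖z‖ = R := by simpa using hz
    have h := norm_extrapFun_le B.L B.L' B.κM hC0 hC (P := B.auxForm ξ) (D := D)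
      ((isHomogeneous_homog D (B.QOf ξ)).totalDegree_le) B.v (B.gridDir cg) k z
    rw [hzR] at h
    exact h
  -- the lower bound for `∏ (z - c)^S` on the circle
  have hsep : ∀ z ∈ sphere (0 : ℂ) R, ∀ c ∈ pts, R / 2 ≤ ‖z - c‖ := by
    intro z hz c hc
    have hzR : ‖z‖ = R := by simpa using hz
    obtain ⟨j, hj, rfl⟩ := Finset.mem_image.mp hc
    have hjS : (j : ℝ) ≤ S₀ := by exact_mod_cast Nat.lt_succ_iff.mp (Finset.mem_range.mp hj)
    have h1 : ‖z‖ - ‖(j : ℂ)‖ ≤ ‖z - (j : ℂ)‖ := norm_sub_norm_le z j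
    rw [hzR, Complex.norm_natCast] at h1
    have hs0 : (0 : ℝ) ≤ s := Nat.cast_nonneg s
    linarith
  have hm : (0 : ℝ) < (R / 2) ^ ((T - k) * pts.card) := pow_pos (by linarith) _
  have hmF : ∀ z ∈ sphere (0 : ℂ) R, (R / 2) ^ ((T - k) * pts.card) ≤ ‖∏ c ∈ pts, (z - c) ^ (T - k)‖ :=
    fun z hz => Baker1975.Analytic.le_norm_prod_pow pts (T - k) (by linarith) (hsep z hz)
  have hsR : ‖(s : ℂ)‖ ≤ R := by
    rw [Complex.norm_natCast]
    have : (0 : ℝ) ≤ S₀ := Nat.cast_nonneg S₀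
    have hs0 : (0 : ℝ) ≤ s := Nat.cast_nonneg s
    linarith
  have hmain := Baker1975.Analytic.norm_le_of_analyticOrderAt hdiff pts (T - k) hord hR0 hθb hm hmF hsR
  -- `|∏ (s - c)^S| ≤ (s + S₀)^{S (S₀+1)}`
  have hup : ‖∏ c ∈ pts, ((s : ℂ) - c) ^ (T - k)‖ ≤ ((s : ℝ) + S₀) ^ ((T - k) * pts.card) := by
    refine Baker1975.Analytic.norm_prod_pow_le pts (T - k) fun c hc => ?_
    obtain ⟨j, hj, rfl⟩ := Finset.mem_image.mp hc
    have hjS : (j : ℝ) ≤ S₀ := by exact_mod_cast Nat.lt_succ_iff.mp (Finset.mem_range.mp hj)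
    calc ‖(s : ℂ) - (j : ℂ)‖ ≤ ‖(s : ℂ)‖ + ‖(j : ℂ)‖ := norm_sub_le _ _
      _ = s + j := by rw [Complex.norm_natCast, Complex.norm_natCast]
      _ ≤ s + S₀ := by linarith
  rw [hcard] at hm hup hmain
  -- assemble
  have hθ0 : 0 ≤ θ := by
    rw [hθ]; have := Nesterenko.l1Norm_nonneg (B.auxForm ξ); positivity
  have hA0 : (0 : ℝ) ≤ (s : ℝ) + S₀ := by positivity
  have step1 : ‖f s‖ ≤ θ * (2 * ((s : ℝ) + S₀) / R) ^ ((T - k) * (S₀ + 1)) := by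
    refine hmain.trans ?_
    have e : θ / (R / 2) ^ ((T - k) * (S₀ + 1)) * ((s : ℝ) + S₀) ^ ((T - k) * (S₀ + 1)) =
        θ * (2 * ((s : ℝ) + S₀) / R) ^ ((T - k) * (S₀ + 1)) := by
      rw [show 2 * ((s : ℝ) + S₀) / R = (2 / R) * ((s : ℝ) + S₀) from by ring, mul_pow, div_pow, div_pow]
      field_simp
    rw [← e]
    exact mul_le_mul_of_nonneg_left hup (div_nonneg hθ0 hm.le)
  refine step1.trans (mul_le_mul_of_nonneg_right ?_ (by positivity))
  -- `θ ≤ k! · (#U · H_ξ · e^{…})^… `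
  rw [hθ]
  refine mul_le_mul_of_nonneg_left ?_ (Nat.cast_nonneg _)
  have hX := B.norm_gridDir_le hcg
  have hexp : Real.exp (C * (1 + (R * ‖B.v‖ + ‖B.gridDir cg‖) ^ 2)) ≤
      Real.exp (C * (1 + (R * ‖B.v‖ + k * B.dirNorm) ^ 2)) := by
    refine Real.exp_le_exp.mpr (mul_le_mul_of_nonneg_left ?_ hC0)
    have h1 : 0 ≤ R * ‖B.v‖ + ‖B.gridDir cg‖ := by positivity
    nlinarith [norm_nonneg (B.gridDir cg)]
  have hcoeff := (B.l1Norm_homog_QOf_le ξ).trans (B.sum_norm_xi_le ξ)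
  have hHξ := B.one_le_houseXi ξ
  have hE1 : 1 ≤ Real.exp (C * (1 + (R * ‖B.v‖ + k * B.dirNorm) ^ 2)) := Real.one_le_exp (by positivity)
  calc Nesterenko.l1Norm (B.auxForm ξ) * Real.exp (C * (1 + (R * ‖B.v‖ + ‖B.gridDir cg‖) ^ 2)) ^ D
      ≤ (Fintype.card (UIdx β (γ ⊕ γ') δ D') * B.houseXi ξ) * Real.exp (C * (1 + (R * ‖B.v‖ + k * B.dirNorm) ^ 2)) ^ D :=
        mul_le_mul hcoeff (pow_le_pow_left₀ (Real.exp_nonneg _) hexp D) (pow_nonneg (Real.exp_nonneg _) _)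
          (by positivity)
    _ = _ := by ring


/-- **The extrapolation estimate with scaled radius** (`r = 1/(kX + 1)`): for `v ∈ 𝔟`,
vanishing to order `≥ T` along `𝔟` at `0, …, S₀v`, `c_m ≤ k`, `R ≥ 2(s + S₀)`, `R > 0`:
`|φ_{x_c,k}(s)| ≤ k!·(kX+1)^k·#U·H_ξ·e^{C(1+(R‖v‖+1)²)·D}·(2(s+S₀)/R)^{(T-k)(S₀+1)}`.
[cite: Baker1975, Ch. 2 Lemma 4; BakerWustholz2007, §6.8 (p. 119)] -/
theorem norm_extrapFun_grid_le₂ {C : ℝ} (hC0 : 0 ≤ C)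
    (hC : ∀ (J : Option β × ThetaIdx (γ ⊕ γ') δ) (w : β ⊕ ((γ ⊕ γ') ⊕ δ) → ℂ),
      ‖theta B.L B.L' B.κM J w‖ ≤ Real.exp (C * (1 + ‖w‖ ^ 2)))
    (hv : B.v ∈ B.bSpan) {D' : ℕ} (ξ : UIdx β (γ ⊕ γ') δ D' → 𝓞 B.K) {T S₀ : ℕ}
    (hvan : ∀ s₀ : ℕ, s₀ ≤ S₀ → VanishesAlong B.bSpan (thetaEval B.L B.L' B.κM (B.auxForm ξ)) ((s₀ : ℂ) • B.v) T)
    {k : ℕ} {cg : Fin B.dd → ℕ} (hcg : ∀ m, cg m ≤ k) (s : ℕ) {R : ℝ} (hR0 : 0 < R)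
    (hR : 2 * ((s : ℝ) + S₀) ≤ R) :
    ‖extrapFun B.L B.L' B.κM (B.auxForm ξ) B.v (B.gridDir cg) k s‖ ≤
      k.factorial * ((k : ℝ) * B.dirNorm + 1) ^ k * (Fintype.card (UIdx β (γ ⊕ γ') δ D') * B.houseXi ξ *
        Real.exp (C * (1 + (R * ‖B.v‖ + 1) ^ 2)) ^ (Fintype.card (β ⊕ ((γ ⊕ γ') ⊕ δ)) * D')) *
        (2 * ((s : ℝ) + S₀) / R) ^ ((T - k) * (S₀ + 1)) := by
  set D := Fintype.card (β ⊕ ((γ ⊕ γ') ⊕ δ)) * D' with hD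
  set f := extrapFun B.L B.L' B.κM (B.auxForm ξ) B.v (B.gridDir cg) k with hf
  set r : ℝ := 1 / ((k : ℝ) * B.dirNorm + 1) with hr
  have hX0 := B.dirNorm_nonneg
  have hr0 : 0 < r := by rw [hr]; positivity
  have hrx : r * ‖B.gridDir cg‖ ≤ 1 := by
    have hX := B.norm_gridDir_le hcg
    rw [hr, one_div, inv_mul_le_iff₀ (by positivity)]
    linarith
  set pts : Finset ℂ := (Finset.range (S₀ + 1)).image (fun j : ℕ => (j : ℂ)) with hpts
  have hcard : pts.card = S₀ + 1 := by
    rw [hpts, Finset.card_image_of_injective _ Nat.cast_injective, Finset.card_range]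
  have hdiff : Differentiable ℂ f := differentiable_extrapFun B.L B.L' B.κM _ _ _ k
  have hord : ∀ c ∈ pts, ((T - k : ℕ) : ℕ∞) ≤ analyticOrderAt f c := by
    intro c hc
    obtain ⟨j, hj, rfl⟩ := Finset.mem_image.mp hc
    have hjS : j ≤ S₀ := Nat.lt_succ_iff.mp (Finset.mem_range.mp hj)
    exact le_analyticOrderAt_extrapFun B.L B.L' B.κM _ hv (B.gridDir_mem cg) (hvan j hjS) k
  -- the bound on the circle `|z| = R` with Cauchy radius `r` in `ξ`
  set θ : ℝ := k.factorial * (Nesterenko.l1Norm (B.auxForm ξ) *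
    Real.exp (C * (1 + (R * ‖B.v‖ + 1) ^ 2)) ^ D) / r ^ k with hθ
  have hθb : ∀ z ∈ sphere (0 : ℂ) R, ‖f z‖ ≤ θ := by
    intro z hz
    have hzR : ‖z‖ = R := by simpa using hz
    have h := norm_extrapFun_le_radius B.L B.L' B.κM hC0 hC (P := B.auxForm ξ) (D := D)
      ((isHomogeneous_homog D (B.QOf ξ)).totalDegree_le) B.v (B.gridDir cg) k z hr0
    rw [hzR] at h
    refine h.trans ?_
    rw [hθ]
    refine div_le_div_of_nonneg_right (mul_le_mul_of_nonneg_left (mul_le_mul_of_nonneg_left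
      (pow_le_pow_left₀ (Real.exp_nonneg _) (Real.exp_le_exp.mpr (mul_le_mul_of_nonneg_left ?_ hC0)) D)
      (Nesterenko.l1Norm_nonneg _)) (Nat.cast_nonneg _)) (pow_nonneg hr0.le _)
    have h1 : 0 ≤ R * ‖B.v‖ + r * ‖B.gridDir cg‖ := by positivity
    nlinarith
  -- separation and products as in `norm_extrapFun_grid_le`
  have hsep : ∀ z ∈ sphere (0 : ℂ) R, ∀ c ∈ pts, R / 2 ≤ ‖z - c‖ := by
    intro z hz c hc
    have hzR : ‖z‖ = R := by simpa using hz
    obtain ⟨j, hj, rfl⟩ := Finset.mem_image.mp hc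
    have hjS : (j : ℝ) ≤ S₀ := by exact_mod_cast Nat.lt_succ_iff.mp (Finset.mem_range.mp hj)
    have h1 : ‖z‖ - ‖(j : ℂ)‖ ≤ ‖z - (j : ℂ)‖ := norm_sub_norm_le z j
    rw [hzR, Complex.norm_natCast] at h1
    have hs0 : (0 : ℝ) ≤ s := Nat.cast_nonneg s
    linarith
  have hm : (0 : ℝ) < (R / 2) ^ ((T - k) * pts.card) := pow_pos (by linarith) _
  have hmF : ∀ z ∈ sphere (0 : ℂ) R, (R / 2) ^ ((T - k) * pts.card) ≤ ‖∏ c ∈ pts, (z - c) ^ (T - k)‖ :=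
    fun z hz => Baker1975.Analytic.le_norm_prod_pow pts (T - k) (by linarith) (hsep z hz)
  have hsR : ‖(s : ℂ)‖ ≤ R := by
    rw [Complex.norm_natCast]
    have : (0 : ℝ) ≤ S₀ := Nat.cast_nonneg S₀
    have hs0 : (0 : ℝ) ≤ s := Nat.cast_nonneg s
    linarith
  have hmain := Baker1975.Analytic.norm_le_of_analyticOrderAt hdiff pts (T - k) hord hR0 hθb hm hmF hsR
  have hup : ‖∏ c ∈ pts, ((s : ℂ) - c) ^ (T - k)‖ ≤ ((s : ℝ) + S₀) ^ ((T - k) * pts.card) := by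
    refine Baker1975.Analytic.norm_prod_pow_le pts (T - k) fun c hc => ?_
    obtain ⟨j, hj, rfl⟩ := Finset.mem_image.mp hc
    have hjS : (j : ℝ) ≤ S₀ := by exact_mod_cast Nat.lt_succ_iff.mp (Finset.mem_range.mp hj)
    calc ‖(s : ℂ) - (j : ℂ)‖ ≤ ‖(s : ℂ)‖ + ‖(j : ℂ)‖ := norm_sub_le _ _
      _ = s + j := by rw [Complex.norm_natCast, Complex.norm_natCast]
      _ ≤ s + S₀ := by linarith
  rw [hcard] at hm hup hmain
  have hθ0 : 0 ≤ θ := by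
    rw [hθ]; have := Nesterenko.l1Norm_nonneg (B.auxForm ξ); positivity
  have step1 : ‖f s‖ ≤ θ * (2 * ((s : ℝ) + S₀) / R) ^ ((T - k) * (S₀ + 1)) := by
    refine hmain.trans ?_
    have e : θ / (R / 2) ^ ((T - k) * (S₀ + 1)) * ((s : ℝ) + S₀) ^ ((T - k) * (S₀ + 1)) =
        θ * (2 * ((s : ℝ) + S₀) / R) ^ ((T - k) * (S₀ + 1)) := by
      rw [show 2 * ((s : ℝ) + S₀) / R = (2 / R) * ((s : ℝ) + S₀) from by ring, mul_pow, div_pow, div_pow]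
      field_simp
    rw [← e]
    exact mul_le_mul_of_nonneg_left hup (div_nonneg hθ0 hm.le)
  refine step1.trans (mul_le_mul_of_nonneg_right ?_ (by positivity))
  -- `θ ≤ k!·(kX+1)^k·#U·H_ξ·e^{…}`
  rw [hθ, hr, one_div, inv_pow, div_eq_mul_inv, inv_inv]
  have hcoeff := (B.l1Norm_homog_QOf_le ξ).trans (B.sum_norm_xi_le ξ)
  have hHξ := B.one_le_houseXi ξ
  have hE0 : 0 ≤ Real.exp (C * (1 + (R * ‖B.v‖ + 1) ^ 2)) ^ D := pow_nonneg (Real.exp_nonneg _) _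
  have hkX : 0 ≤ ((k : ℝ) * B.dirNorm + 1) ^ k := by positivity
  calc (k.factorial : ℝ) * (Nesterenko.l1Norm (B.auxForm ξ) * Real.exp (C * (1 + (R * ‖B.v‖ + 1) ^ 2)) ^ D) *
        ((k : ℝ) * B.dirNorm + 1) ^ k
      ≤ (k.factorial : ℝ) * ((Fintype.card (UIdx β (γ ⊕ γ') δ D') * B.houseXi ξ) *
          Real.exp (C * (1 + (R * ‖B.v‖ + 1) ^ 2)) ^ D) * ((k : ℝ) * B.dirNorm + 1) ^ k := by
        refine mul_le_mul_of_nonneg_right (mul_le_mul_of_nonneg_left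
          (mul_le_mul_of_nonneg_right hcoeff hE0) (Nat.cast_nonneg _)) hkX
    _ = _ := by ring


/-- **The extrapolation estimate with zeros at the spaced multiples `(ℓ j)·v`, `j ≤ S₀`** (scaled
Cauchy radius `r = 1/(kX + 1)`): for `v ∈ 𝔟`, vanishing to order `≥ T` along `𝔟` at `(ℓ j)·v`,
`j ≤ S₀`, `c_m ≤ k`, `R ≥ 2(s + ℓS₀)`, `R > 0`:
`|φ_{x_c,k}(s)| ≤ k!·(kX+1)^k·#U·H_ξ·e^{C(1+(R‖v‖+1)²)·D}·(2(s+ℓS₀)/R)^{(T-k)(S₀+1)}`.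
[cite: BakerWustholz2007, §6.8 (p. 119: ψ(w) = Ψ(ℓw), Schwarz with r' = S, r = S²)] -/
theorem norm_extrapFun_grid_le₃ {C : ℝ} (hC0 : 0 ≤ C)
    (hC : ∀ (J : Option β × ThetaIdx (γ ⊕ γ') δ) (w : β ⊕ ((γ ⊕ γ') ⊕ δ) → ℂ),
      ‖theta B.L B.L' B.κM J w‖ ≤ Real.exp (C * (1 + ‖w‖ ^ 2)))
    (hv : B.v ∈ B.bSpan) {D' : ℕ} (ξ : UIdx β (γ ⊕ γ') δ D' → 𝓞 B.K) {ℓ T S₀ : ℕ} (hℓ : 0 < ℓ)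
    (hvan : ∀ j : ℕ, j ≤ S₀ →
      VanishesAlong B.bSpan (thetaEval B.L B.L' B.κM (B.auxForm ξ)) (((ℓ * j : ℕ) : ℂ) • B.v) T)
    {k : ℕ} {cg : Fin B.dd → ℕ} (hcg : ∀ m, cg m ≤ k) (s : ℕ) {R : ℝ} (hR0 : 0 < R)
    (hR : 2 * ((s : ℝ) + ℓ * S₀) ≤ R) :
    ‖extrapFun B.L B.L' B.κM (B.auxForm ξ) B.v (B.gridDir cg) k s‖ ≤
      k.factorial * ((k : ℝ) * B.dirNorm + 1) ^ k * (Fintype.card (UIdx β (γ ⊕ γ') δ D') * B.houseXi ξ *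
        Real.exp (C * (1 + (R * ‖B.v‖ + 1) ^ 2)) ^ (Fintype.card (β ⊕ ((γ ⊕ γ') ⊕ δ)) * D')) *
        (2 * ((s : ℝ) + ℓ * S₀) / R) ^ ((T - k) * (S₀ + 1)) := by
  set D := Fintype.card (β ⊕ ((γ ⊕ γ') ⊕ δ)) * D' with hD
  set f := extrapFun B.L B.L' B.κM (B.auxForm ξ) B.v (B.gridDir cg) k with hf
  set r : ℝ := 1 / ((k : ℝ) * B.dirNorm + 1) with hr
  have hX0 := B.dirNorm_nonneg
  have hr0 : 0 < r := by rw [hr]; positivity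
  have hrx : r * ‖B.gridDir cg‖ ≤ 1 := by
    have hX := B.norm_gridDir_le hcg
    rw [hr, one_div, inv_mul_le_iff₀ (by positivity)]
    linarith
  -- the spaced points `ℓ j`, `j ≤ S₀`
  set pts : Finset ℂ := (Finset.range (S₀ + 1)).image (fun j : ℕ => ((ℓ * j : ℕ) : ℂ)) with hpts
  have hinj : Function.Injective (fun j : ℕ => ((ℓ * j : ℕ) : ℂ)) := by
    intro j j' hjj'
    have hjj'' : ((ℓ * j : ℕ) : ℂ) = ((ℓ * j' : ℕ) : ℂ) := hjj'
    have : ℓ * j = ℓ * j' := by exact_mod_cast hjj''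
    exact Nat.eq_of_mul_eq_mul_left hℓ this
  have hcard : pts.card = S₀ + 1 := by
    rw [hpts, Finset.card_image_of_injective _ hinj, Finset.card_range]
  have hℓS0 : (0 : ℝ) ≤ (ℓ : ℝ) * S₀ := by positivity
  have hptnorm : ∀ c ∈ pts, ‖c‖ ≤ (ℓ : ℝ) * S₀ := by
    intro c hc
    obtain ⟨j, hj, rfl⟩ := Finset.mem_image.mp hc
    have hjS : (j : ℝ) ≤ S₀ := by exact_mod_cast Nat.lt_succ_iff.mp (Finset.mem_range.mp hj)
    rw [Complex.norm_natCast]; push_cast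
    exact mul_le_mul_of_nonneg_left hjS (Nat.cast_nonneg ℓ)
  have hdiff : Differentiable ℂ f := differentiable_extrapFun B.L B.L' B.κM _ _ _ k
  have hord : ∀ c ∈ pts, ((T - k : ℕ) : ℕ∞) ≤ analyticOrderAt f c := by
    intro c hc
    obtain ⟨j, hj, rfl⟩ := Finset.mem_image.mp hc
    have hjS : j ≤ S₀ := Nat.lt_succ_iff.mp (Finset.mem_range.mp hj)
    exact le_analyticOrderAt_extrapFun B.L B.L' B.κM _ hv (B.gridDir_mem cg) (hvan j hjS) k
  -- the bound on the circle `|z| = R` with Cauchy radius `r` in `ξ`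
  set θ : ℝ := k.factorial * (Nesterenko.l1Norm (B.auxForm ξ) *
    Real.exp (C * (1 + (R * ‖B.v‖ + 1) ^ 2)) ^ D) / r ^ k with hθ
  have hθb : ∀ z ∈ sphere (0 : ℂ) R, ‖f z‖ ≤ θ := by
    intro z hz
    have hzR : ‖z‖ = R := by simpa using hz
    have h := norm_extrapFun_le_radius B.L B.L' B.κM hC0 hC (P := B.auxForm ξ) (D := D)
      ((isHomogeneous_homog D (B.QOf ξ)).totalDegree_le) B.v (B.gridDir cg) k z hr0
    rw [hzR] at h
    refine h.trans ?_
    rw [hθ]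
    refine div_le_div_of_nonneg_right (mul_le_mul_of_nonneg_left (mul_le_mul_of_nonneg_left
      (pow_le_pow_left₀ (Real.exp_nonneg _) (Real.exp_le_exp.mpr (mul_le_mul_of_nonneg_left ?_ hC0)) D)
      (Nesterenko.l1Norm_nonneg _)) (Nat.cast_nonneg _)) (pow_nonneg hr0.le _)
    have h1 : 0 ≤ R * ‖B.v‖ + r * ‖B.gridDir cg‖ := by positivity
    nlinarith
  -- separation on the circle: `|z - ℓj| ≥ R - ℓS₀ ≥ R/2`
  have hsep : ∀ z ∈ sphere (0 : ℂ) R, ∀ c ∈ pts, R / 2 ≤ ‖z - c‖ := by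
    intro z hz c hc
    have hzR : ‖z‖ = R := by simpa using hz
    have hc' := hptnorm c hc
    have h1 : ‖z‖ - ‖c‖ ≤ ‖z - c‖ := norm_sub_norm_le z c
    rw [hzR] at h1
    have hs0 : (0 : ℝ) ≤ s := Nat.cast_nonneg s
    linarith
  have hm : (0 : ℝ) < (R / 2) ^ ((T - k) * pts.card) := pow_pos (by linarith) _
  have hmF : ∀ z ∈ sphere (0 : ℂ) R, (R / 2) ^ ((T - k) * pts.card) ≤ ‖∏ c ∈ pts, (z - c) ^ (T - k)‖ :=
    fun z hz => Baker1975.Analytic.le_norm_prod_pow pts (T - k) (by linarith) (hsep z hz)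
  have hsR : ‖(s : ℂ)‖ ≤ R := by
    rw [Complex.norm_natCast]
    have hs0 : (0 : ℝ) ≤ s := Nat.cast_nonneg s
    linarith
  have hmain := Baker1975.Analytic.norm_le_of_analyticOrderAt hdiff pts (T - k) hord hR0 hθb hm hmF hsR
  have hup : ‖∏ c ∈ pts, ((s : ℂ) - c) ^ (T - k)‖ ≤ ((s : ℝ) + ℓ * S₀) ^ ((T - k) * pts.card) := by
    refine Baker1975.Analytic.norm_prod_pow_le pts (T - k) fun c hc => ?_
    have hc' := hptnorm c hc
    calc ‖(s : ℂ) - c‖ ≤ ‖(s : ℂ)‖ + ‖c‖ := norm_sub_le _ _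
      _ = s + ‖c‖ := by rw [Complex.norm_natCast]
      _ ≤ s + ℓ * S₀ := by linarith
  rw [hcard] at hm hup hmain
  have hθ0 : 0 ≤ θ := by
    rw [hθ]; have := Nesterenko.l1Norm_nonneg (B.auxForm ξ); positivity
  have step1 : ‖f s‖ ≤ θ * (2 * ((s : ℝ) + ℓ * S₀) / R) ^ ((T - k) * (S₀ + 1)) := by
    refine hmain.trans ?_
    have e : θ / (R / 2) ^ ((T - k) * (S₀ + 1)) * ((s : ℝ) + ℓ * S₀) ^ ((T - k) * (S₀ + 1)) =
        θ * (2 * ((s : ℝ) + ℓ * S₀) / R) ^ ((T - k) * (S₀ + 1)) := by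
      rw [show 2 * ((s : ℝ) + ℓ * S₀) / R = (2 / R) * ((s : ℝ) + ℓ * S₀) from by ring, mul_pow, div_pow, div_pow]
      field_simp
    rw [← e]
    exact mul_le_mul_of_nonneg_left hup (div_nonneg hθ0 hm.le)
  refine step1.trans (mul_le_mul_of_nonneg_right ?_ (by positivity))
  -- `θ ≤ k!·(kX+1)^k·#U·H_ξ·e^{…}`
  rw [hθ, hr, one_div, inv_pow, div_eq_mul_inv, inv_inv]
  have hcoeff := (B.l1Norm_homog_QOf_le ξ).trans (B.sum_norm_xi_le ξ)
  have hHξ := B.one_le_houseXi ξ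
  have hE0 : 0 ≤ Real.exp (C * (1 + (R * ‖B.v‖ + 1) ^ 2)) ^ D := pow_nonneg (Real.exp_nonneg _) _
  have hkX : 0 ≤ ((k : ℝ) * B.dirNorm + 1) ^ k := by positivity
  calc (k.factorial : ℝ) * (Nesterenko.l1Norm (B.auxForm ξ) * Real.exp (C * (1 + (R * ‖B.v‖ + 1) ^ 2)) ^ D) *
        ((k : ℝ) * B.dirNorm + 1) ^ k
      ≤ (k.factorial : ℝ) * ((Fintype.card (UIdx β (γ ⊕ γ') δ D') * B.houseXi ξ) *
          Real.exp (C * (1 + (R * ‖B.v‖ + 1) ^ 2)) ^ D) * ((k : ℝ) * B.dirNorm + 1) ^ k := by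
        refine mul_le_mul_of_nonneg_right (mul_le_mul_of_nonneg_left
          (mul_le_mul_of_nonneg_right hcoeff hE0) (Nat.cast_nonneg _)) hkX
    _ = _ := by ring


/-- **The constant `c_Θ > 0`** of the lower bound `c_Θ e^{-C'_Θ(1+s²)} ≤ |Θ_{J₀(c_s)}(s·v)|`. [folklore] -/
def thetaLowc : ℝ := B.exists_theta_baseIdx_ge.choose


/-- **The constant `C'_Θ ≥ 0`** of the lower bound. [folklore] -/
def thetaLowC : ℝ := B.exists_theta_baseIdx_ge.choose_spec.2.choose


omit [DecidableEq β] [DecidableEq δ] in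
/-- The defining properties of `c_Θ, C'_Θ`. [folklore] -/
theorem thetaLow_spec : 0 < B.thetaLowc ∧ 0 ≤ B.thetaLowC ∧ ∀ s : ℕ,
    B.thetaLowc * Real.exp (-(B.thetaLowC * (1 + (s : ℝ) ^ 2))) ≤
      ‖theta B.L B.L' B.κM (baseIdx (B.cAt s)) ((s : ℂ) • B.v)‖ :=
  ⟨B.exists_theta_baseIdx_ge.choose_spec.1, B.exists_theta_baseIdx_ge.choose_spec.2.choose_spec.1,
    B.exists_theta_baseIdx_ge.choose_spec.2.choose_spec.2⟩


/-- **The numerical condition** on the parameters `(D', T, S₀, S₁, T', R)` and the coefficient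
vector `ξ` under which extrapolation + Liouville force the vanishing at the new points: for all
`s ≤ S₁`, `k < T'`,
`k!·(#U·H_ξ·e^{C_Θ(1+(R‖v‖+kX)²)})^{D}·(2(s+S₀)/R)^{(T-k)(S₀+1)} · |d_s|^E (|d_s|^E Λ_{s,k})^{h-1}
  < (c_Θ e^{-C'_Θ(1+s²)})^{D}` (`D = nD'`, `E = E(D,k)`, `Λ` = `lineValBound`). [folklore] -/
def NumCond {D' : ℕ} (ξ : UIdx β (γ ⊕ γ') δ D' → 𝓞 B.K) (T S₀ S₁ T' : ℕ) (R : ℝ) : Prop :=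
  ∀ s : ℕ, s ≤ S₁ → ∀ k : ℕ, k < T' →
    (k.factorial : ℝ) * (Fintype.card (UIdx β (γ ⊕ γ') δ D') * B.houseXi ξ *
        Real.exp (thetaGrowthC (β := β) B.L B.L' B.κM * (1 + (R * ‖B.v‖ + k * B.dirNorm) ^ 2)) ^
          (Fintype.card (β ⊕ ((γ ⊕ γ') ⊕ δ)) * D')) *
      (2 * ((s : ℝ) + S₀) / R) ^ ((T - k) * (S₀ + 1)) *
      (|(B.dAt s : ℝ)| ^ B.expE (Fintype.card (β ⊕ ((γ ⊕ γ') ⊕ δ)) * D') k *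
        (|(B.dAt s : ℝ)| ^ B.expE (Fintype.card (β ⊕ ((γ ⊕ γ') ⊕ δ)) * D') k * B.lineValBound ξ s k) ^
          (B.gens.h - 1)) <
    (B.thetaLowc * Real.exp (-(B.thetaLowC * (1 + (s : ℝ) ^ 2)))) ^ (Fintype.card (β ⊕ ((γ ⊕ γ') ⊕ δ)) * D')


/-- **Vanishing at the new points.** If `v ∈ 𝔟`, the auxiliary form `F_P` (`P = homog D (QOf ξ)`)
vanishes to order `≥ T` along `𝔟` at `0, v, …, S₀v`, `R ≥ 2(S₁ + S₀)`, `R > 0`, and the numerical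
condition holds, then `F_P` vanishes to order `≥ T'` along `𝔟` at `s·v` for all `s ≤ S₁`.
[cite: BakerWustholz2007, §6.8 (p. 119)] -/
theorem vanishesAlong_newPoints (hv : B.v ∈ B.bSpan) {D' : ℕ} (ξ : UIdx β (γ ⊕ γ') δ D' → 𝓞 B.K)
    {T S₀ S₁ T' : ℕ} {R : ℝ} (hR0 : 0 < R) (hR : 2 * ((S₁ : ℝ) + S₀) ≤ R)
    (hvan : ∀ s₀ : ℕ, s₀ ≤ S₀ → VanishesAlong B.bSpan (thetaEval B.L B.L' B.κM (B.auxForm ξ)) ((s₀ : ℂ) • B.v) T)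
    (hnum : B.NumCond ξ T S₀ S₁ T' R) {s : ℕ} (hs : s ≤ S₁) :
    VanishesAlong B.bSpan (thetaEval B.L B.L' B.κM (B.auxForm ξ)) ((s : ℂ) • B.v) T' := by
  obtain ⟨hC0, hC⟩ := thetaGrowthC_spec (β := β) B.L B.L' B.κM
  obtain ⟨hc0, hC'0, hlow⟩ := B.thetaLow_spec
  refine B.vanishesAlong_of_small ξ s T' fun k hk cg hcg => ?_
  have hRs : 2 * ((s : ℝ) + S₀) ≤ R := by
    have : (s : ℝ) ≤ S₁ := by exact_mod_cast hs
    linarith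
  have hφ := B.norm_extrapFun_grid_le hC0 hC hv ξ hvan hcg s hR0 hRs
  have hΛ : 0 ≤ |(B.dAt s : ℝ)| ^ B.expE (Fintype.card (β ⊕ ((γ ⊕ γ') ⊕ δ)) * D') k *
      (|(B.dAt s : ℝ)| ^ B.expE (Fintype.card (β ⊕ ((γ ⊕ γ') ⊕ δ)) * D') k * B.lineValBound ξ s k) ^ (B.gens.h - 1) := by
    have := B.lineValBound_nonneg ξ s k
    positivity
  have hΘ : (B.thetaLowc * Real.exp (-(B.thetaLowC * (1 + (s : ℝ) ^ 2)))) ^ (Fintype.card (β ⊕ ((γ ⊕ γ') ⊕ δ)) * D') ≤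
      ‖theta B.L B.L' B.κM (baseIdx (B.cAt s)) ((s : ℂ) • B.v)‖ ^ (Fintype.card (β ⊕ ((γ ⊕ γ') ⊕ δ)) * D') :=
    pow_le_pow_left₀ (by positivity) (hlow s) _
  calc ‖extrapFun B.L B.L' B.κM (B.auxForm ξ) B.v (B.gridDir cg) k s‖ *
        (|(B.dAt s : ℝ)| ^ B.expE (Fintype.card (β ⊕ ((γ ⊕ γ') ⊕ δ)) * D') k *
          (|(B.dAt s : ℝ)| ^ B.expE (Fintype.card (β ⊕ ((γ ⊕ γ') ⊕ δ)) * D') k * B.lineValBound ξ s k) ^ (B.gens.h - 1))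
      ≤ _ := mul_le_mul_of_nonneg_right hφ hΛ
    _ < _ := hnum s hs k hk
    _ ≤ _ := hΘ


/-- The Siegel house bound for the coefficients `ξ_u` (`SiegelWrapper.siegelConst`). [folklore] -/
def siegelHouseBound (D' T S₀ : ℕ) : ℝ :=
  siegelConst B.K * (siegelConst B.K * ((D' + 1) ^ Fintype.card (β ⊕ ((γ ⊕ γ') ⊕ δ)) : ℕ) * B.houseBound D' T S₀) ^
    ((((S₀ + 1) * T ^ B.dd : ℕ) : ℝ) /
      ((((D' + 1) ^ Fintype.card (β ⊕ ((γ ⊕ γ') ⊕ δ)) : ℕ) : ℝ) - ((S₀ + 1) * T ^ B.dd : ℕ)))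


/-- **The Baker engine on `M_κ`.** Let `v ∈ 𝔟`, `T ≥ 1`, `(S₀+1)·T^{dd} < (D'+1)^n` (Siegel
feasibility, sharp count), `R > 0`, `R ≥ 2(S₁ + S₀)`, and suppose the numerical condition `NumCond` holds for
every coefficient vector `ξ` whose houses are within the Siegel bound. Then there is a form `P`,
homogeneous of degree `nD'`, with `F_P ≢ 0` and `F_P` vanishing to order `≥ T'` along `𝔟` at `s·v`
for all `s ≤ S₁`. [cite: BakerWustholz2007, §6.8 (pp. 118–119)] -/
theorem engine (hv : B.v ∈ B.bSpan) (D' T S₀ S₁ T' : ℕ) (R : ℝ) (hT : 0 < T)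
    (hpq : (S₀ + 1) * T ^ B.dd < (D' + 1) ^ Fintype.card (β ⊕ ((γ ⊕ γ') ⊕ δ)))
    (hR0 : 0 < R) (hR : 2 * ((S₁ : ℝ) + S₀) ≤ R)
    (hnum : ∀ ξ : UIdx β (γ ⊕ γ') δ D' → 𝓞 B.K,
      (∀ u, house ((ξ u : 𝓞 B.K) : B.K) ≤ B.siegelHouseBound D' T S₀) → B.NumCond ξ T S₀ S₁ T' R) :
    ∃ P : MvPolynomial (Option β × ThetaIdx (γ ⊕ γ') δ) ℂ,
      P.IsHomogeneous (Fintype.card (β ⊕ ((γ ⊕ γ') ⊕ δ)) * D') ∧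
      (∃ w, thetaEval B.L B.L' B.κM P w ≠ 0) ∧
      ∀ s : ℕ, s ≤ S₁ → VanishesAlong B.bSpan (thetaEval B.L B.L' B.κM P) ((s : ℂ) • B.v) T' := by
  obtain ⟨ξ, -, hhouse, hne, hvan⟩ := B.exists_auxiliary₂ D' T S₀ hT hpq
  refine ⟨B.auxForm ξ, isHomogeneous_homog _ _, hne, fun s hs => ?_⟩
  exact B.vanishesAlong_newPoints hv ξ hR0 hR (fun s₀ hs₀ => hvan s₀ hs₀) (hnum ξ hhouse) hs


/-- **The numerical condition (scaled form)**: for all `s ≤ S₁`, `k < T'`,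
`k!·(kX+1)^k·#U·H_ξ·e^{C_Θ(1+(R‖v‖+1)²)·D}·(2(s+S₀)/R)^{(T-k)(S₀+1)} · |d_s|^E (|d_s|^E Λ_{s,k})^{h-1}
  < (c_Θ e^{-C'_Θ(1+s²)})^{D}` (`D = nD'`). [folklore] -/
def NumCond₂ {D' : ℕ} (ξ : UIdx β (γ ⊕ γ') δ D' → 𝓞 B.K) (T S₀ S₁ T' : ℕ) (R : ℝ) : Prop :=
  ∀ s : ℕ, s ≤ S₁ → ∀ k : ℕ, k < T' →
    (k.factorial : ℝ) * ((k : ℝ) * B.dirNorm + 1) ^ k * (Fintype.card (UIdx β (γ ⊕ γ') δ D') * B.houseXi ξ *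
        Real.exp (thetaGrowthC (β := β) B.L B.L' B.κM * (1 + (R * ‖B.v‖ + 1) ^ 2)) ^
          (Fintype.card (β ⊕ ((γ ⊕ γ') ⊕ δ)) * D')) *
      (2 * ((s : ℝ) + S₀) / R) ^ ((T - k) * (S₀ + 1)) *
      (|(B.dAt s : ℝ)| ^ B.expE (Fintype.card (β ⊕ ((γ ⊕ γ') ⊕ δ)) * D') k *
        (|(B.dAt s : ℝ)| ^ B.expE (Fintype.card (β ⊕ ((γ ⊕ γ') ⊕ δ)) * D') k * B.lineValBound ξ s k) ^
          (B.gens.h - 1)) <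
    (B.thetaLowc * Real.exp (-(B.thetaLowC * (1 + (s : ℝ) ^ 2)))) ^ (Fintype.card (β ⊕ ((γ ⊕ γ') ⊕ δ)) * D')


/-- **Vanishing at the new points (scaled form).** [cite: BakerWustholz2007, §6.8 (p. 119)] -/
theorem vanishesAlong_newPoints₂ (hv : B.v ∈ B.bSpan) {D' : ℕ} (ξ : UIdx β (γ ⊕ γ') δ D' → 𝓞 B.K)
    {T S₀ S₁ T' : ℕ} {R : ℝ} (hR0 : 0 < R) (hR : 2 * ((S₁ : ℝ) + S₀) ≤ R)
    (hvan : ∀ s₀ : ℕ, s₀ ≤ S₀ → VanishesAlong B.bSpan (thetaEval B.L B.L' B.κM (B.auxForm ξ)) ((s₀ : ℂ) • B.v) T)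
    (hnum : B.NumCond₂ ξ T S₀ S₁ T' R) {s : ℕ} (hs : s ≤ S₁) :
    VanishesAlong B.bSpan (thetaEval B.L B.L' B.κM (B.auxForm ξ)) ((s : ℂ) • B.v) T' := by
  obtain ⟨hC0, hC⟩ := thetaGrowthC_spec (β := β) B.L B.L' B.κM
  obtain ⟨hc0, hC'0, hlow⟩ := B.thetaLow_spec
  refine B.vanishesAlong_of_small ξ s T' fun k hk cg hcg => ?_
  have hRs : 2 * ((s : ℝ) + S₀) ≤ R := by
    have : (s : ℝ) ≤ S₁ := by exact_mod_cast hs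
    linarith
  have hφ := B.norm_extrapFun_grid_le₂ hC0 hC hv ξ hvan hcg s hR0 hRs
  have hΛ : 0 ≤ |(B.dAt s : ℝ)| ^ B.expE (Fintype.card (β ⊕ ((γ ⊕ γ') ⊕ δ)) * D') k *
      (|(B.dAt s : ℝ)| ^ B.expE (Fintype.card (β ⊕ ((γ ⊕ γ') ⊕ δ)) * D') k * B.lineValBound ξ s k) ^ (B.gens.h - 1) := by
    have := B.lineValBound_nonneg ξ s k
    positivity
  have hΘ : (B.thetaLowc * Real.exp (-(B.thetaLowC * (1 + (s : ℝ) ^ 2)))) ^ (Fintype.card (β ⊕ ((γ ⊕ γ') ⊕ δ)) * D') ≤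
      ‖theta B.L B.L' B.κM (baseIdx (B.cAt s)) ((s : ℂ) • B.v)‖ ^ (Fintype.card (β ⊕ ((γ ⊕ γ') ⊕ δ)) * D') :=
    pow_le_pow_left₀ (by positivity) (hlow s) _
  calc ‖extrapFun B.L B.L' B.κM (B.auxForm ξ) B.v (B.gridDir cg) k s‖ *
        (|(B.dAt s : ℝ)| ^ B.expE (Fintype.card (β ⊕ ((γ ⊕ γ') ⊕ δ)) * D') k *
          (|(B.dAt s : ℝ)| ^ B.expE (Fintype.card (β ⊕ ((γ ⊕ γ') ⊕ δ)) * D') k * B.lineValBound ξ s k) ^ (B.gens.h - 1))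
      ≤ _ := mul_le_mul_of_nonneg_right hφ hΛ
    _ < _ := hnum s hs k hk
    _ ≤ _ := hΘ


/-- **The Baker engine (scaled form).** `v ∈ 𝔟`, `T ≥ 1`, `(S₀+1)·T^{dd} < (D'+1)^n`, `R > 0`,
`R ≥ 2(S₁ + S₀)`, and `NumCond₂` for every coefficient vector within the Siegel house bound
`⇒ ∃ P` homogeneous of degree `nD'`, `F_P ≢ 0`, `VanishesAlong 𝔟 F_P (s·v) T'` for `s ≤ S₁`.
[cite: BakerWustholz2007, §6.8 (pp. 118–119)] -/
theorem engine₂ (hv : B.v ∈ B.bSpan) (D' T S₀ S₁ T' : ℕ) (R : ℝ) (hT : 0 < T)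
    (hpq : (S₀ + 1) * T ^ B.dd < (D' + 1) ^ Fintype.card (β ⊕ ((γ ⊕ γ') ⊕ δ)))
    (hR0 : 0 < R) (hR : 2 * ((S₁ : ℝ) + S₀) ≤ R)
    (hnum : ∀ ξ : UIdx β (γ ⊕ γ') δ D' → 𝓞 B.K,
      (∀ u, house ((ξ u : 𝓞 B.K) : B.K) ≤ B.siegelHouseBound D' T S₀) → B.NumCond₂ ξ T S₀ S₁ T' R) :
    ∃ P : MvPolynomial (Option β × ThetaIdx (γ ⊕ γ') δ) ℂ,
      P.IsHomogeneous (Fintype.card (β ⊕ ((γ ⊕ γ') ⊕ δ)) * D') ∧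
      (∃ w, thetaEval B.L B.L' B.κM P w ≠ 0) ∧
      ∀ s : ℕ, s ≤ S₁ → VanishesAlong B.bSpan (thetaEval B.L B.L' B.κM P) ((s : ℂ) • B.v) T' := by
  obtain ⟨ξ, -, hhouse, hne, hvan⟩ := B.exists_auxiliary₂ D' T S₀ hT hpq
  refine ⟨B.auxForm ξ, isHomogeneous_homog _ _, hne, fun s hs => ?_⟩
  exact B.vanishesAlong_newPoints₂ hv ξ hR0 hR (fun s₀ hs₀ => hvan s₀ hs₀) (hnum ξ hhouse) hs


/-- A solution of the spaced system kills the row sums of the rows of order `< T`. [folklore] -/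
theorem rowSum_eq_zero_of_mulVec₃ {ℓ D' T S₀ : ℕ} {ξ : UIdx β (γ ⊕ γ') δ D' → 𝓞 B.K}
    (h : (B.sMat₃ ℓ D' T S₀).mulVec ξ = 0) (r : B.EIdx₂ T S₀) (hr : B.rowOrder r.2 < T) :
    ∑ u, (ξ u : B.K) * B.rowSum (Fintype.card (β ⊕ ((γ ⊕ γ') ⊕ δ)) * D') (ℓ * r.1) (B.rowOrder r.2) r.2 (νOf u) = 0 := by
  have hrow := congrFun h r
  simp only [Matrix.mulVec, dotProduct, Pi.zero_apply] at hrow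
  have hrow' := congrArg (algebraMap (𝓞 B.K) B.K) hrow
  rw [map_sum, map_zero] at hrow'
  simp only [map_mul] at hrow'
  have e : ∑ u, algebraMap (𝓞 B.K) B.K (B.sMat₃ ℓ D' T S₀ r u) * algebraMap (𝓞 B.K) B.K (ξ u) =
      (B.dAt (ℓ * r.1) : B.K) ^ B.expE (Fintype.card (β ⊕ ((γ ⊕ γ') ⊕ δ)) * D') (B.rowOrder r.2) *
        ∑ u, (ξ u : B.K) * B.rowSum (Fintype.card (β ⊕ ((γ ⊕ γ') ⊕ δ)) * D') (ℓ * r.1) (B.rowOrder r.2) r.2 (νOf u) := by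
    rw [Finset.mul_sum]
    refine Finset.sum_congr rfl fun u _ => ?_
    rw [show algebraMap (𝓞 B.K) B.K (B.sMat₃ ℓ D' T S₀ r u) = ((B.sMat₃ ℓ D' T S₀ r u : 𝓞 B.K) : B.K) from rfl,
      show algebraMap (𝓞 B.K) B.K (ξ u) = ((ξ u : 𝓞 B.K) : B.K) from rfl]
    simp only [sMat₃, if_pos hr]
    show ((B.dAt (ℓ * r.1) : B.K) ^ _ * B.rowSum _ _ _ _ _) * _ = _
    ring
  rw [e] at hrow'
  exact (mul_eq_zero.mp hrow').resolve_left (pow_ne_zero _ (B.dAt_ne_zero _))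


/-- **The spaced system encodes the vanishing conditions at `(ℓ s)·v`, `s ≤ S₀`.**
[cite: BakerWustholz2007, §6.8 (p. 118)] -/
theorem vanishesAlong_of_mulVec₃ {ℓ D' T S₀ : ℕ} {ξ : UIdx β (γ ⊕ γ') δ D' → 𝓞 B.K}
    (h : (B.sMat₃ ℓ D' T S₀).mulVec ξ = 0) {s : ℕ} (hs : s ≤ S₀) :
    VanishesAlong (Submodule.span ℂ (Set.range B.xs))
      (thetaEval B.L B.L' B.κM (homog (Fintype.card (β ⊕ ((γ ⊕ γ') ⊕ δ)) * D') (B.QOf ξ))) (((ℓ * s : ℕ) : ℂ) • B.v) T := by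
  set D := Fintype.card (β ⊕ ((γ ⊕ γ') ⊕ δ)) * D' with hD
  refine vanishesAlong_span_of_wordForms B.L B.L' B.κM (isHomogeneous_homog D _) (B.cAt (ℓ * s))
    (fun x => zero_mem_chartDomain_chartChoiceAt B.L B.L' _ x) B.xs T fun k hk α => ?_
  -- word forms of `P`
  have hP : ∀ ω : Fin k → Fin B.dd, wordForm B.L B.L' B.κM (B.cAt (ℓ * s)) B.xs (((ℓ * s : ℕ) : ℂ) • B.v) ω (homog D (B.QOf ξ)) =
      B.emb (∑ u, (ξ u : B.K) * B.entryVal (ℓ * s) ω D (νOf u)) := fun ω => B.wordForm_homog_QOf ξ (ℓ * s) ω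
  by_cases hsum : ∑ m, (α m : ℕ) = k
  · -- the row `(s, α)` of order `k`
    let α' : Fin B.dd → Fin T := fun m => ⟨α m, lt_of_lt_of_le (α m).isLt (Nat.succ_le_of_lt hk)⟩
    have hord : B.rowOrder α' = k := by simp [rowOrder, α', hsum]
    have hrow := B.rowSum_eq_zero_of_mulVec₃ h (⟨s, Nat.lt_succ_of_le hs⟩, α') (by rw [hord]; exact hk)
    simp only [hord] at hrow
    have hset : Finset.univ.filter (fun ω : Fin k → Fin B.dd => ∀ m, PolyODE.content ω m = α m) =
        B.wordsOf k α' := by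
      ext ω; simp [wordsOf, α']
    rw [Finset.sum_congr rfl fun ω _ => hP ω, ← map_sum, hset]
    rw [show ∑ ω ∈ B.wordsOf k α', ∑ u, (ξ u : B.K) * B.entryVal (ℓ * s) ω D (νOf u) =
        ∑ u, (ξ u : B.K) * B.rowSum D (ℓ * s) k α' (νOf u) from by
      rw [Finset.sum_comm]
      refine Finset.sum_congr rfl fun u _ => ?_
      rw [rowSum, Finset.mul_sum]]
    rw [hrow, map_zero]
  · -- no word of length `k` has content `α`
    refine Finset.sum_eq_zero fun ω hω => ?_
    exfalso
    apply hsum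
    have hc := (Finset.mem_filter.mp hω).2
    calc ∑ m, (α m : ℕ) = ∑ m, PolyODE.content ω m := Finset.sum_congr rfl fun m _ => (hc m).symm
      _ = k := PolyODE.sum_content ω


/-- The Siegel house bound of the spaced system: the bound of `SiegelWrapper.siegel_house` with
`p = (S₀+1)T^{dd}` rows, `q = (D'+1)^n` unknowns and entry bound `houseBound D' T (ℓS₀)`. [folklore] -/
def siegelHouseBound₃ (ℓ D' T S₀ : ℕ) : ℝ :=
  siegelConst B.K * (siegelConst B.K * ((D' + 1) ^ Fintype.card (β ⊕ ((γ ⊕ γ') ⊕ δ)) : ℕ) * B.houseBound D' T (ℓ * S₀)) ^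
    ((((S₀ + 1) * T ^ B.dd : ℕ) : ℝ) /
      ((((D' + 1) ^ Fintype.card (β ⊕ ((γ ⊕ γ') ⊕ δ)) : ℕ) : ℝ) - ((S₀ + 1) * T ^ B.dd : ℕ)))


/-- **The auxiliary function with conditions at the spaced multiples `(ℓ s)·v`, `s ≤ S₀`.** For
`T ≥ 1` and `(S₀+1)·T^{dd} < (D'+1)^n` there is `ξ ≠ 0` in `𝓞 K^{unknowns}` within
`siegelHouseBound₃` such that `P = homog (nD') (QOf ξ)` has `F_P ≢ 0` and vanishes to order `≥ T`
along `𝔟` at `(ℓ s)·v`, `s ≤ S₀`. [cite: BakerWustholz2007, §6.8 (pp. 117–118)] -/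
theorem exists_auxiliary₃ (ℓ D' T S₀ : ℕ) (hT : 0 < T)
    (hpq : (S₀ + 1) * T ^ B.dd < (D' + 1) ^ Fintype.card (β ⊕ ((γ ⊕ γ') ⊕ δ))) :
    ∃ ξ : UIdx β (γ ⊕ γ') δ D' → 𝓞 B.K, ξ ≠ 0 ∧
      (∀ u, house ((ξ u : 𝓞 B.K) : B.K) ≤ B.siegelHouseBound₃ ℓ D' T S₀) ∧
      (∃ w, thetaEval B.L B.L' B.κM (B.auxForm ξ) w ≠ 0) ∧
      ∀ s ≤ S₀, VanishesAlong B.bSpan (thetaEval B.L B.L' B.κM (B.auxForm ξ)) (((ℓ * s : ℕ) : ℂ) • B.v) T := by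
  have h0p : 0 < (S₀ + 1) * T ^ B.dd := Nat.mul_pos (Nat.succ_pos _) (pow_pos hT _)
  obtain ⟨ξ, hξ, hmul, hhouse⟩ := siegel_house B.K (B.sMat₃ ℓ D' T S₀) h0p hpq (B.card_EIdx₂ T S₀) (card_UIdx D')
    (B.one_le_houseBound D' T (ℓ * S₀)) (fun r u => B.house_sMat₃_le ℓ D' T S₀ r u)
  refine ⟨ξ, hξ, fun u => hhouse u, ?_, fun s hs => B.vanishesAlong_of_mulVec₃ hmul hs⟩
  exact exists_thetaEval_homog_ne_zero B.L B.L' B.κM (B.QOf_ne_zero hξ) (B.totalDegree_QOf_le ξ)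


/-- **The numerical condition of the torsion case**: for all `s ≤ S₁`, `k < T'`,
`k!·(kX+1)^k·#U·H_ξ·e^{C_Θ(1+(R‖v‖+1)²)·D}·(2(s+ℓS₀)/R)^{(T-k)(S₀+1)} · |d_s|^E (|d_s|^E Λ_{s,k})^{h-1}
  < (c_Θ e^{-C'_Θ(1+s²)})^{D}` (`D = nD'`): `NewPointsScaled.NumCond₂` with the saving factor of the
spaced zeros `ℓ j`, `j ≤ S₀`. [folklore] -/
def NumCond₃ {D' : ℕ} (ξ : UIdx β (γ ⊕ γ') δ D' → 𝓞 B.K) (ℓ T S₀ S₁ T' : ℕ) (R : ℝ) : Prop :=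
  ∀ s : ℕ, s ≤ S₁ → ∀ k : ℕ, k < T' →
    (k.factorial : ℝ) * ((k : ℝ) * B.dirNorm + 1) ^ k * (Fintype.card (UIdx β (γ ⊕ γ') δ D') * B.houseXi ξ *
        Real.exp (thetaGrowthC (β := β) B.L B.L' B.κM * (1 + (R * ‖B.v‖ + 1) ^ 2)) ^
          (Fintype.card (β ⊕ ((γ ⊕ γ') ⊕ δ)) * D')) *
      (2 * ((s : ℝ) + ℓ * S₀) / R) ^ ((T - k) * (S₀ + 1)) *
      (|(B.dAt s : ℝ)| ^ B.expE (Fintype.card (β ⊕ ((γ ⊕ γ') ⊕ δ)) * D') k *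
        (|(B.dAt s : ℝ)| ^ B.expE (Fintype.card (β ⊕ ((γ ⊕ γ') ⊕ δ)) * D') k * B.lineValBound ξ s k) ^
          (B.gens.h - 1)) <
    (B.thetaLowc * Real.exp (-(B.thetaLowC * (1 + (s : ℝ) ^ 2)))) ^ (Fintype.card (β ⊕ ((γ ⊕ γ') ⊕ δ)) * D')


/-- **Vanishing at the new points (torsion case).** If `v ∈ 𝔟`, the auxiliary form vanishes to
order `≥ T` along `𝔟` at the spaced multiples `(ℓ j)·v`, `j ≤ S₀` (`ℓ ≥ 1`), `R ≥ 2(S₁ + ℓS₀) > 0`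
and `NumCond₃` holds, then it vanishes to order `≥ T'` along `𝔟` at `s·v` for every `s ≤ S₁`.
[cite: BakerWustholz2007, §6.8 (p. 119: "We conclude that Ψ(s) = 0 … for all integers s = 0, …, ℓS")] -/
theorem vanishesAlong_newPoints₃ (hv : B.v ∈ B.bSpan) {D' : ℕ} (ξ : UIdx β (γ ⊕ γ') δ D' → 𝓞 B.K)
    {ℓ T S₀ S₁ T' : ℕ} {R : ℝ} (hℓ : 0 < ℓ) (hR0 : 0 < R) (hR : 2 * ((S₁ : ℝ) + ℓ * S₀) ≤ R)
    (hvan : ∀ j : ℕ, j ≤ S₀ →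
      VanishesAlong B.bSpan (thetaEval B.L B.L' B.κM (B.auxForm ξ)) (((ℓ * j : ℕ) : ℂ) • B.v) T)
    (hnum : B.NumCond₃ ξ ℓ T S₀ S₁ T' R) {s : ℕ} (hs : s ≤ S₁) :
    VanishesAlong B.bSpan (thetaEval B.L B.L' B.κM (B.auxForm ξ)) ((s : ℂ) • B.v) T' := by
  obtain ⟨hC0, hC⟩ := thetaGrowthC_spec (β := β) B.L B.L' B.κM
  obtain ⟨hc0, hC'0, hlow⟩ := B.thetaLow_spec
  refine B.vanishesAlong_of_small ξ s T' fun k hk cg hcg => ?_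
  have hRs : 2 * ((s : ℝ) + ℓ * S₀) ≤ R := by
    have : (s : ℝ) ≤ S₁ := by exact_mod_cast hs
    linarith
  have hφ := B.norm_extrapFun_grid_le₃ hC0 hC hv ξ hℓ hvan hcg s hR0 hRs
  have hΛ : 0 ≤ |(B.dAt s : ℝ)| ^ B.expE (Fintype.card (β ⊕ ((γ ⊕ γ') ⊕ δ)) * D') k *
      (|(B.dAt s : ℝ)| ^ B.expE (Fintype.card (β ⊕ ((γ ⊕ γ') ⊕ δ)) * D') k * B.lineValBound ξ s k) ^ (B.gens.h - 1) := by
    have := B.lineValBound_nonneg ξ s k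
    positivity
  have hΘ : (B.thetaLowc * Real.exp (-(B.thetaLowC * (1 + (s : ℝ) ^ 2)))) ^ (Fintype.card (β ⊕ ((γ ⊕ γ') ⊕ δ)) * D') ≤
      ‖theta B.L B.L' B.κM (baseIdx (B.cAt s)) ((s : ℂ) • B.v)‖ ^ (Fintype.card (β ⊕ ((γ ⊕ γ') ⊕ δ)) * D') :=
    pow_le_pow_left₀ (by positivity) (hlow s) _
  calc ‖extrapFun B.L B.L' B.κM (B.auxForm ξ) B.v (B.gridDir cg) k s‖ *
        (|(B.dAt s : ℝ)| ^ B.expE (Fintype.card (β ⊕ ((γ ⊕ γ') ⊕ δ)) * D') k *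
          (|(B.dAt s : ℝ)| ^ B.expE (Fintype.card (β ⊕ ((γ ⊕ γ') ⊕ δ)) * D') k * B.lineValBound ξ s k) ^ (B.gens.h - 1))
      ≤ _ := mul_le_mul_of_nonneg_right hφ hΛ
    _ < _ := hnum s hs k hk
    _ ≤ _ := hΘ


omit [DecidableEq β] [DecidableEq δ] in
/-- `(ℓ j)·v = j·(ℓ·v)`. [folklore] -/
theorem mul_smul_eq (ℓ j : ℕ) : ((ℓ * j : ℕ) : ℂ) • B.v = (j : ℂ) • ((ℓ : ℂ) • B.v) := by
  rw [smul_smul, Nat.cast_mul, mul_comm]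


/-- **The Baker engine of the torsion case.** Let `v ∈ 𝔟` with `(ℓ(S_rows+1))·v ∈ ker` (`ℓ ≥ 1`),
`T ≥ 1`, `(S_rows+1)·T^{dd} < (D'+1)^n` (Siegel feasibility with the rows at `(ℓ s₀)·v`,
`s₀ ≤ S_rows` only), `R > 0`, `R ≥ 2(S₁ + ℓS₀)`, and suppose `NumCond₃` holds for every coefficient
vector within the Siegel house bound `siegelHouseBound₃`. Then there is a form `P`, homogeneous of
degree `nD'`, with `F_P ≢ 0` and `F_P` vanishing to order `≥ T'` along `𝔟` at `s·v` for all
`s ≤ S₁`. [cite: BakerWustholz2007, §6.8 (pp. 117–119)] -/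
theorem engine₃ (hv : B.v ∈ B.bSpan) (ℓ D' T Srows S₀ S₁ T' : ℕ) (R : ℝ) (hℓ : 0 < ℓ) (hT : 0 < T)
    (hpq : (Srows + 1) * T ^ B.dd < (D' + 1) ^ Fintype.card (β ⊕ ((γ ⊕ γ') ⊕ δ)))
    (hper : ((ℓ * (Srows + 1) : ℕ) : ℂ) • B.v ∈ ker B.L B.L' B.κM)
    (hR0 : 0 < R) (hR : 2 * ((S₁ : ℝ) + ℓ * S₀) ≤ R)
    (hnum : ∀ ξ : UIdx β (γ ⊕ γ') δ D' → 𝓞 B.K,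
      (∀ u, house ((ξ u : 𝓞 B.K) : B.K) ≤ B.siegelHouseBound₃ ℓ D' T Srows) →
        B.NumCond₃ ξ ℓ T S₀ S₁ T' R) :
    ∃ P : MvPolynomial (Option β × ThetaIdx (γ ⊕ γ') δ) ℂ,
      P.IsHomogeneous (Fintype.card (β ⊕ ((γ ⊕ γ') ⊕ δ)) * D') ∧
      (∃ w, thetaEval B.L B.L' B.κM P w ≠ 0) ∧
      ∀ s : ℕ, s ≤ S₁ → VanishesAlong B.bSpan (thetaEval B.L B.L' B.κM P) ((s : ℂ) • B.v) T' := by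
  obtain ⟨ξ, -, hhouse, hne, hvan⟩ := B.exists_auxiliary₃ ℓ D' T Srows hT hpq
  refine ⟨B.auxForm ξ, isHomogeneous_homog _ _, hne, fun s hs => ?_⟩
  -- vanishing at ALL the spaced multiples `(ℓ j)·v` by `ker`-periodicity
  have hall : ∀ j : ℕ, VanishesAlong B.bSpan (thetaEval B.L B.L' B.κM (B.auxForm ξ)) (((ℓ * j : ℕ) : ℂ) • B.v) T := by
    intro j
    rw [B.mul_smul_eq]
    refine vanishesAlong_all_multiples B.L B.L' B.κM (isHomogeneous_homog _ (B.QOf ξ)) B.bSpan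
      (u := (ℓ : ℂ) • B.v) (P₁ := Srows + 1) (Nat.succ_pos _) ?_ (fun s₀ hs₀ => ?_) j
    · rw [← B.mul_smul_eq]; exact hper
    · rw [← B.mul_smul_eq]; exact hvan s₀ (Nat.lt_succ_iff.mp hs₀)
  exact B.vanishesAlong_newPoints₃ hv ξ hℓ hR0 hR (fun j _ => hall j) (hnum ξ hhouse) hs


end BakerData

end Engine

end Std

end GaGmEE

end Literature.NumberTheory.Transcendental

end
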